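import Mathlib
import HarnessLib
import Literature.Analysis.FluidPDE.LagrangianLatticeCarrier
import Summits.AnomalousDissipation.AnomalousDissipation.Theses.SolenoidalFractalHomogenisation
import Literature.Analysis.FluidPDE.PassiveVectorTensor
import Summits.AnomalousDissipation.AnomalousDissipation.Theorems.SolenoidalFractalHomogenisationLagrangianStepDefs
import Summits.AnomalousDissipation.AnomalousDissipation.Theorems.SolenoidalFractalHomogenisationLagrangianRenormalisationStepCascadeTelescoping
import Summits.AnomalousDissipation.AnomalousDissipation.Theorems.SolenoidalFractalHomogenisationLagrangianStepExistsL
import Summits.AnomalousDissipation.AnomalousDissipation.Theorems.SolenoidalFractalHomogenisationLagrangianStepBaseT  -- v14: stub_baseT DISCHARGED by p612457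
import Summits.AnomalousDissipation.AnomalousDissipation.Theorems.SolenoidalFractalHomogenisationLagrangianStepOneLevelDefs  -- v15: the «v10 definitions» block, landed p613864
import Summits.AnomalousDissipation.AnomalousDissipation.Theorems.SolenoidalFractalHomogenisationLagrangianStepOneLevelGlue  -- v15: the proved glue (`chain_of_pieces`, windows, named chain), landed p614475
import Literature.Analysis.FluidPDE.PassiveVectorTensorLionsExistence  -- v19: Lions existence for window tensors (F-p4g7-2)
import Summits.AnomalousDissipation.AnomalousDissipation.Theorems.SolenoidalFractalHomogenisationRealisedQuasiStaticCellLawSingleMode  -- v20: single-mode datum facts (F-p4g7-3)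
import Summits.AnomalousDissipation.AnomalousDissipation.Theorems.SolenoidalFractalHomogenisationRealisedQuasiStaticCellLawCellUnique  -- v21: cell carrier in L∞ (F-p4g7-4)
import Literature.Analysis.FluidPDE.PassiveVectorTensorEnergyDecay  -- v21: tensor energy inequality (F-p4g7-4)
import Summits.AnomalousDissipation.AnomalousDissipation.Theorems.SolenoidalFractalHomogenisationLagrangianRenormalisationStepExistsL

/-!
v21 CANDIDATE (ideator planner ad-ideate-p4 g7, 2026-08-28, finding F-p4g7-4 — NOT registered; for the tenure planner; stacks on the v20 candidate; same SHARED-DEFS caveat: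
adoptable once `CellEnergyClausesNoE` + lemmas land in `Theorems/…LagrangianStep…`): = v20 with the ENERGY-INEQUALITY sub-conjunct
`∫ x, ‖u t x‖ ^ 2 ≤ ∫ x, ‖F x‖ ^ 2 ∧` of clause (F) removed from `stub_cellEnergyT`: its conclusion now ends in `CellEnergyClausesNoE` (local def =
landed `CellEnergyClauses` VERBATIM minus that conjunct), and the composition feeds `stub_oneLevelL` the FULL clauses through the proved
`cellEnergyT_of_cellEnergyTNoE` (Literature `Torus.IsWeakTensorPassiveVectorOn.ae_energy_ineq` [Temam1984 III §1 Lemma 1.2] + window ellipticity of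
`(1/n²)•𝔸` + K2R's `memLp_top_stLift_cell` (the cell carrier IS a `LatticeWord.cell`) + `IsDatum F` ⇒ `L²`, div-free).  A weakening; one token in the
composition.  `lean check`: rc 0, sorries 4.  Typed sketch: `Cruxes/LagrangianRenormalisationStep/CellEnergyTNoESketch.lean`.
-/

/-!
v20 CANDIDATE (ideator planner ad-ideate-p4 g7, 2026-08-28, finding F-p4g7-3 — NOT registered; for the tenure planner; stacks on the v19 candidate):
= v19 with the EXISTENCE sub-conjunct of the slow-vector clause (V) removed from `stub_cellLawV`: its conclusion now ends in `SlowVectorClauseNoEx`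
(local def = landed `SlowVectorClause` VERBATIM minus `(∃ v, IsWeakTensorPassiveVectorOn 0 (2T) (effective tensor) 0 (Re e_ℓ • p) v) ∧`), and the
composition feeds `stub_oneLevelL` the FULL clause through the proved `cellLawV_of_cellLawVNoEx` (window clause ⇒ ellipticity of the effective
tensor `nearIso_effTensor` ⇒ Lions carrier-free existence `Torus.exists_isWeakTensorPassiveVectorOn_zero_carrier` (Literature, Amendment 1 of
2026-08-28, written for this conjunct) from the single-mode datum (K2R's `memSobolev_one_singleMode`, `isWeaklyDivFree_singleMode`)).  A weakening;
one token in the composition; the Floquet–Bloch prover of cellLawV no longer owes a PDE-existence statement.  `lean check`: rc 0, sorries 4.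
Typed sketch: `Cruxes/LagrangianRenormalisationStep/CellLawVNoExSketch.lean`.
-/

/-!
v19 CANDIDATE (ideator planner ad-ideate-p4 g7, 2026-08-28, finding F-p4g7-2 — NOT registered; for the tenure planner): = v18 with the EXISTENCE
conjunct `(∃ v, TSol E m (k̄_m • renormStep Φ g S) w₀ v) ∧` of `stub_oneLevelL` DELETED (a weakening; every other binder byte-identical).
It is J.-L. Lions' theorem, in the Literature since `PassiveVectorTensorLionsExistence.lean` (`Torus.exists_isWeakTensorPassiveVectorOn`, any
`NearIso 𝔸 lo hi`, `lo > 0`, bounded a.e.-div-free carrier — its docstring names this consumer), + `renormStep_window` (p614475) + `NearIso.smul`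
+ the partial-sum carrier package of p611352: proved below in «## Existence of the renormalised level-m problem» (`nearIso_smul_renormStep`,
`existsL_tensor`, `existsL_renorm`, adapter `oneLevel_of_oneLevelNoExists` : v19-statement → v18-statement); the composition changes by ONE
token (`stub_oneLevelL` ↦ `(oneLevel_of_oneLevelNoExists stub_oneLevelL)`).  Active stubs: tailL (L) · cellLawV (XL) · cellEnergyT (L) ·
oneLevelL (XL−, now = the one-sided drop-ratio comparison ALONE).  `lean check`: rc 0, sorries 4.  Typed sketch:
`Cruxes/LagrangianRenormalisationStep/ExistsRenormSketch.lean`.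
-/

/-!
v18 (REGISTERED by tenure planner ad-ideate-p1 g23, 2026-08-28 ~11:00Z gate time; re-cut AUTHORED by ideator planner ad-ideate-p4 g7, finding F-p4g7-1, adopted verbatim from Cruxes/LagrangianRenormalisationStep/BirthV18Candidate.lean sha16 29f19bd9e721f02e): = v17 with the UNCONSUMED
upper drop ratio deleted.  `cascade_of_chain_abstract` (p609829) never uses `drop u ≤ (1 + Cρ^σ) drop v` (it destructures `⟨⟨_, hlow, _⟩, …⟩` /
`ht.2.1`) and `Cascade` is one-sided, so (i) `stub_oneLevelL` loses the last line of its conclusion (a WEAKENING: v17's stub implies v18's by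
dropping a conjunct — every other binder byte-identical), (ii) `stub_cascadeT` reads `ChainLower E → Cascade E` (still discharged, by the inlined
`cascade_of_chainLower` = the landed telescoping proof with the unused hypothesis conjunct removed), (iii) the composition calls
`chainLower_of_pieces` (= landed `chain_of_pieces` verbatim, last line `⟨…, h1⟩` instead of `⟨…, h1.1, h1.2⟩`).  The block «## One-sided chain glue»
below is sorry-free and is meant to be LANDED as `Theorems/SolenoidalFractalHomogenisationLagrangianStepOneLevelGlueLower.lean` (same content, namespace
`…Theorems.SolenoidalFractalHomogenisation.LagrangianStep`) and then replaced by an import, exactly as v15 did for v10's glue.  Active stubs unchanged in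
number and names: tailL (L) · cellLawV (XL) · cellEnergyT (L) · oneLevelL (XL−, now ONE-SIDED = the decay direction `‖u(t)‖² ≤ ‖v(t)‖² + Cρ^σ·drop v`).
Idea card: `Cruxes/LagrangianRenormalisationStep/Ideas/signed-corrector-ledger.md`; typed sketch `…/OneSidedChainSketch.lean`.
-/

/-!
v17 (TENURE RE-CUT by planner ad-ideate-p1 g23, 2026-08-28T11:1xZ, after ideator planner ad-ideate-p4 g6's finding F-p4g6-1 / K3L card
`Cruxes/LagrangianCarrierConstruction/Ideas/distortion-trapping-ceiling.md`, and in lock-step with K3L skeleton v8): = v16 with ONE stub re-cut —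
`stub_tailL` becomes `∀ k (W : LatticeWord k), ∃ Λ₁ : ℕ, ∃ θs : ℝ, 0 < θs ∧ ∀ E, E.design = W → … → ∀ θ₀ : ℝ, θ₀ ≤ θs → (T4 θ₀) → …` (the prover CHOOSES a
design-dependent separation `Λ₁` AND strain-budget ceiling `θs`; the other binders byte-identical to v16), and the composition instantiates K1L's `∃ θ₀ > 0`
at `min θ₀ θs` (`θ₀` from `stub_oneLevelL`; (T4) is monotone in the budget, so the chain gets its clause at `θ₀` and the tail stub its clause at `θs`).  WHY: the
uniform flow-distortion bound for the levels above `j` that the tail estimate needs is, by the norms-only frame recursion, available only under a smallness of the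
strain budget (K3L v8 docstring); v16 asked it for every `θ₀`.  Zero cost to the crux.  `stub_cellLawV`, `stub_cellEnergyT`, `stub_oneLevelL`, the by-name stubs
and everything else: unchanged from v16 (sha16 fea4db9d5ee35e0e).

v16 (TENURE RE-CUT by planner ad-ideate-p1 g23, 2026-08-28, RULING R23-1): = the lead's registered v15 (prover ad-solenoidal-k2r-lowerlaw-p1 g5,
sha16 fe847e2361999376: v14 with the local blocks «## v10 definitions» + re-cut check + «## Proved glue» replaced by the imports of the landed
`Theorems/…LagrangianStepOneLevelDefs.lean` (p613864) and `Theorems/…LagrangianStepOneLevelGlue.lean` (p614475)), with ONE stub re-cut: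
`stub_tailL` now also receives the K1L template hypotheses that make the tail small — `N m ^ 2 ≤ N (m+1)`, (T2) `cellVisc (m+1)·(N (m+1)/N m)^{1/4} ≤ 1`
(together: `cellVisc (m+1) ≤ N m ^ (-1/4) → 0`) and (T4) `θ (m+1)·(N (m+1)/N m)^{1/16} ≤ θ₀` for an arbitrary `θ₀` (bounded strain budgets ⇒ bounded
flow distortion on refresh windows, `Theorems/…LagrangianCarrierDistortion.lean` p615383) — binder texts byte-identical to K1L's; the composition feeds them
from its own binders (`htail k E hP hR hsep1 hsq h2 θ₀ h4 …`).  WHY (R23-1): from `LPermissible ∧ Regular ∧ lacunarity` alone the stream-potential tail ratio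
`‖ψ_{>j}‖_∞ / kbar j` is only BOUNDED (`≤ (1+θ)²/(8π²√gain)` per level: `Permissible` allows `cellVisc m ≡ ν* < nu0`), not → 0, so v15's `stub_tailL` had no
perturbative proof; with (T2)+(N²) it is `≲ D(θ₀)² · sup_{m>j} cellVisc m / gain → 0` and the landed stream-form stability lemma
`Literature/…/PassiveVectorTensorStreamStability.lean` (p615321, `ae_integral_norm_sq_le_add_of_stream`) closes the PDE half.  The other three ACTIVE stubs
`stub_cellLawV` · `stub_cellEnergyT` · `stub_oneLevelL` and the three discharged ones are byte-identical to v14/v15 (credits carry).  `lean check`: rc 0, sorries 4 (the active stubs).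

HISTORY (v14 note, kept):
v14 (FALLBACK COPY by tenure planner ad-ideate-p1 g22, 2026-08-28T07:3xZ): = tree Lines/onelevel.lean v13 (sha 6054c786, cstrat-24912) with `stub_baseT`
DISCHARGED BY NAME from `…Theorems.SolenoidalFractalHomogenisation.LagrangianStep.stub_baseT` (p612457, lead g5). Active stubs: tailL, cellLawV, cellEnergyT, oneLevelL.
Everything else byte-identical. If cstrat registers its own v14 first, this file is NOT registered.
 # Line `onelevel` (crux-strategist, unit `cstrat-stmt-AnomalousDissipation-24912-g0`, 2026-08-28) — skeleton v13 for the crux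
`LagrangianRenormalisationStep` (K1L, item `stmt-AnomalousDissipation-24912`, rank 2) of route `SolenoidalFractalHomogenisation` (rev 14).
Anomalous dissipation is NOT claimed: the route closes rung F-D1.A0 (`…Theses.SolenoidalFractalHomogenisation.Target`), not the summit.

**What this line changes relative to the registered birth line** (r22 v12 of the tenure seat = r17 v9 over the shared defs p610007, with `stub_cascadeT` DISCHARGED by name from
`…Theorems.SolenoidalFractalHomogenisation.LagrangianRenormalisationStep.cascade_of_chain` (p609829) and `stub_existsL` DISCHARGED by name from
`…Theorems.SolenoidalFractalHomogenisation.LagrangianStep.stub_existsL` (p611352); 4 active stubs baseT · tailL · cellLawT · chainL).  The XL PAIR `stub_cellLawT` / `stub_chainL`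
is re-cut; the other stubs `stub_baseT`, `stub_tailL` (sorried) and `stub_existsL`, `stub_cascadeT` (stated and discharged by name exactly as in r22 v12) are
BYTE-IDENTICAL to v9/v12 (names + signature text), and the
v9 definitions block (v9 l.94–281: `VF`, `IsDatum`, `InClass`, `FullSol`, `drop`, `TSol`, `slotWeight`, `mhat`, `excShape`, `taylorShape`,
`AnisotropyWindow`, `ScalarLawBlock`, `cellField`, `modeCoeff`, `sectorEnergy`, `lowEnergy`, `TensorCellPackage`, `Chain`, `Cascade`) is no longer
local: it is IMPORTED from the landed shared defs file `Theorems/SolenoidalFractalHomogenisationLagrangianStepDefs.lean` (p610007, commit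
c83170635324; namespace `…Theorems.SolenoidalFractalHomogenisation.LagrangianStep`, opened below) exactly as the K1L SHARED-DEFS RULE asks of the
strategist seat (STATUS 2026-08-28T06:12:30Z / 06:52:20Z: «skeleton v10 = v9 with l.94–281 replaced by import + open; stub text unchanged ⇒ credits
carry over»), so the by-name landings (done: `stub_existsL` p611352 ad-prover-2 g8, `cascade_of_chain` p609829 g5; in flight: `stub_baseT`, lead k2r-lowerlaw-p1 g5)
elaborate against THE SAME declarations as this skeleton.

1. `stub_chainL` (the renormalised tensor chain, ALL levels at once, intermediate tensors hidden behind `∃ 𝔸 : ℕ → Visc4`) becomes ONE local stub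
   plus PROVED glue.  The intermediate tensors are NAMED: with the package's large-gain shape map `Φ` and the relative gains
   `g_i = gain / cellVisc_i²`, the exact Taylor recursion of `Permissible` (`kbar m = kbar (m+1)·(1 + g_{m+1})`) read at tensor level is
   `S_m = renormStep Φ g_{m+1} S_{m+1} = (S_{m+1} + g_{m+1}·Φ S_{m+1})/(1 + g_{m+1})`, `S_j = I` (`shapeSeq`; `chainTensor E Φ j m = kbar m • S_m`) —
   the package's effective tensor `𝔸 + (c/ν)Φ(𝔸/ν)` at `𝔸 = cellVisc_{m+1}·S_{m+1}`, `ν = cellVisc_{m+1}`, rescaled to level `m`.  All finite-`ν`,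
   finite-`n`, distortion and refresh-transient effects are booked in the DROP-RATIO error `C ρ_m^σ`, never in the tensors; hence WINDOW PROPAGATION
   IS PROVED (`shapeSeq_window`: `renormStep` is a convex combination of `S` and `Φ S`, both in the `λ = 1` window by the window clause), and so are
   the INDUCTION over `m` and the assembly of `Chain E` (`chainL_of_pieces`).  The new stub `stub_oneLevelL` (XL−, LOCAL in the level: no `j`, no
   chain, no window bookkeeping) is Armstrong–Vicol Prop. 5.2 / §5.3 in Lagrangian frames for ONE consecutive pair `m < m+1`: for every window shape
   `S` at level `m+1` and every class-`R` datum, a weak solution of the level-`m` problem with `kbar_m·renormStep Φ g_{m+1} S` exists, and every pair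
   of weak solutions (level `m+1` with `kbar_{m+1}·S`, level `m` with the renormalised tensor) has energy drops on `(1/2,1)` within the ratio
   `1 ± C₁ρ_m^{σ₁}` for `m ≥ m⋆(E,R)`; the constants `ν₁, K₁, Λ₀, θ₀, C₁, σ₁` are uniform in `E` (all `E`-dependence sits in `m⋆`).
2. `stub_cellLawT` (`∃ M c, TensorCellPackage W M hM c`: shape map + invariant windows + clauses (F) fluctuation data, (V) slow-vector law,
   (C) corrector content, one constant block) becomes TWO stubs of different size and prover profile: `stub_cellLawV` (XL: the shape map `Φ`, its
   invariant windows and the SLOW-VECTOR LAW (V) with the existence of the effective solution — `SlowVectorClause`, the Floquet–Bloch heart) and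
   `stub_cellEnergyT` (L: the CELL-ENERGY clauses (F) + (C) — `CellEnergyClauses` — for EVERY pre-stretch `M`, bookkeeping constant `c > 0` and
   window, with its own constants; two-scale energy estimates in the style of K2R's sector machinery, no shape map, no rate exponent).  The clause
   texts are v9's verbatim, regrouped; `tensorCellPackage_of_clauses` PROVES that window clause + (V) + (F)+(C) with one common constant block is
   exactly v9's `TensorCellPackage` (so the re-cut transcribes nothing wrongly), and `stub_oneLevelL` consumes the two blocks with SEPARATE constants
   (no constant merging needed anywhere).

Five sorried stubs: baseT (M) · tailL (L) · cellLawV (XL) · cellEnergyT (L) · oneLevelL (XL−; hardest together with cellLawV); `stub_existsL` (S/M) and `stub_cascadeT` (M)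
are stated byte-identically and PROVED by name from p611352 / p609829 (as in r22 v12), so they are no longer active stubs.
The composition `LagrangianRenormalisationStep_of` (the ONLY crux-headed theorem of the file, hypothesis-free, the seven stub decls consumed by name) is v9's proof re-fed
(kernel-checked): `chain_of_pieces stub_baseT stub_oneLevelL` builds `Chain E` from the two clause blocks.  `lean check`: sorries only inside `stub_*`.

NEW DEFINITIONS occurring in the new stub signatures: `renormStep`, `WindowClause`, `SlowVectorClause`, `CellEnergyClauses` (and, in the
proved glue only, `shapeSeq`, `chainTensor`).  SHARED-DEFS RULE for them (the strategist names the file): the FIRST landing against any of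
`stub_cellLawV` / `stub_cellEnergyT` / `stub_oneLevelL` is the defs-only sibling file
`Theorems/SolenoidalFractalHomogenisationLagrangianStepOneLevelDefs.lean` (imports `…LagrangianStepDefs`; SAME namespace
`…Theorems.SolenoidalFractalHomogenisation.LagrangianStep`; the block `## v10 definitions` below copied VERBATIM — names, bodies, binder order;
`--supports stmt-AnomalousDissipation-24912 --as helper`); then the tenure/strategist seat re-registers v11 = this file with that block replaced by the
import (stub text unchanged ⇒ credits carry over). -/

set_option linter.dupNamespace false

namespace Summit.AnomalousDissipation.AnomalousDissipation.Cruxes.LagrangianRenormalisationStep.OneLevel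

open Literature.Analysis Literature.Analysis.FluidPDE Literature.Analysis.FunctionSpaces
open MeasureTheory Set Filter
open scoped ENNReal NNReal InnerProductSpace

noncomputable section

open Summit.AnomalousDissipation.AnomalousDissipation.Theses.SolenoidalFractalHomogenisation (LagrangianRenormalisationStep)
open Summit.AnomalousDissipation.AnomalousDissipation.Theorems.SolenoidalFractalHomogenisation.LagrangianStep

/-! ## Definitions of the registered v9 skeleton: IMPORTED (K1L SHARED-DEFS RULE)
`VF IsDatum InClass FullSol drop TSol slotWeight mhat excShape taylorShape AnisotropyWindow ScalarLawBlock cellField modeCoeff sectorEnergy lowEnergy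
TensorCellPackage Chain Cascade` come from `Summits.AnomalousDissipation.AnomalousDissipation.Theorems.SolenoidalFractalHomogenisationLagrangianStepDefs`
(p610007; v9 l.94–281 verbatim) via the `open … LagrangianStep` above — nothing is redeclared here. -/

/-! ## v10 definitions `renormStep shapeSeq chainTensor WindowClause SlowVectorClause CellEnergyClauses` and the re-cut check
`tensorCellPackage_of_clauses` / `clauses_of_tensorCellPackage`: IMPORTED since v15 from `…Theorems.SolenoidalFractalHomogenisationLagrangianStepOneLevelDefs`
(p613864) and `…OneLevelGlue` (p614475), same namespace `…LagrangianStep` (opened above) — nothing is redeclared here. -/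

/-! ## One-sided chain glue (v18, F-p4g7-1; sorry-free; to be landed in `Theorems/…OneLevelGlueLower.lean` and replaced by an import) -/

open Summit.AnomalousDissipation.AnomalousDissipation.Theorems.SolenoidalFractalHomogenisation.LagrangianRenormalisationStep
  (two_pow_le_template ratio_le_half_pow)


/-- **The LOWER renormalised tensor chain of `E`**: `LagrangianStep.Chain E` with the (unconsumed) upper drop ratio deleted. -/
def ChainLower {k : ℕ} (E : LatticeShear.LagrangianLatticeCarrier k) : Prop :=
  ∃ alo > (0:ℝ), ∃ ahi : ℝ, ∃ C > (0:ℝ), ∃ σ > (0:ℝ), ∀ R : ℝ≥0, ∃ mstar : ℕ, ∀ j, mstar ≤ j →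
    ∃ 𝔸 : ℕ → Torus.Visc4 (Fin 3), 𝔸 j = Torus.isoVisc (E.kbar j) ∧
      (∀ m, mstar ≤ m → m ≤ j → Torus.NearIso (𝔸 m) (E.kbar m * alo) (E.kbar m * ahi)) ∧
      ∀ m, mstar ≤ m → m < j → ∀ w₀ : VF, IsDatum w₀ → InClass R w₀ →
        (∃ v, TSol E m (𝔸 m) w₀ v) ∧
        ∀ u v : ℝ → VF, TSol E (m + 1) (𝔸 (m + 1)) w₀ u → TSol E m (𝔸 m) w₀ v →
          ∀ᵐ t ∂(volume.restrict (Ioo (1/2 : ℝ) 1)),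
            0 ≤ drop w₀ v t ∧
            (1 - C * ((E.N m : ℝ) / E.N (m + 1)) ^ σ) * drop w₀ v t ≤ drop w₀ u t

/-- Nothing is lost: the registered two-sided chain gives the lower chain. -/
theorem chainLower_of_chain {k : ℕ} (E : LatticeShear.LagrangianLatticeCarrier k) (h : Chain E) : ChainLower E := by
  obtain ⟨alo, halo, ahi, C, hC, σ, hσ, hR⟩ := h
  refine ⟨alo, halo, ahi, C, hC, σ, hσ, fun R => ?_⟩
  obtain ⟨mstar, hm⟩ := hR R
  refine ⟨mstar, fun j hj => ?_⟩
  obtain ⟨𝔸, h𝔸j, hNI, hstep⟩ := hm j hj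
  refine ⟨𝔸, h𝔸j, hNI, fun m hm1 hm2 w₀ hD hCl => ?_⟩
  obtain ⟨hex, hpair⟩ := hstep m hm1 hm2 w₀ hD hCl
  refine ⟨hex, fun u v hu hv => ?_⟩
  exact (hpair u v hu hv).mono fun t ht => ⟨ht.1, ht.2.1⟩


/-- **Lower chain ⇒ cascade, abstractly.**  `LagrangianRenormalisationStep.cascade_of_chain_abstract` VERBATIM except that the
hypothesis no longer carries the upper ratio `dr w₀ u t ≤ (1 + C ρ^σ) dr w₀ v t` — the landed proof never used it. -/
theorem cascade_of_chainLower_abstract {V A : Type*}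
    (Sol : ℕ → A → V → (ℝ → V) → Prop) (NI : A → ℝ → ℝ → Prop) (iso : ℝ → A)
    (Dat : V → Prop) (Cls : ℝ≥0 → V → Prop) (kbar : ℕ → ℝ) (N : ℕ → ℕ) (dr : V → (ℝ → V) → ℝ → ℝ)
    (L : Filter ℝ)
    (hN : ∀ m, 0 < N m) (h2 : ∀ m, 2 * N m ≤ N (m + 1)) (hsq : ∀ m, N m ^ 2 ≤ N (m + 1))
    (hCh : ∃ alo > (0:ℝ), ∃ ahi : ℝ, ∃ C > (0:ℝ), ∃ σ > (0:ℝ), ∀ R : ℝ≥0, ∃ mstar : ℕ, ∀ j, mstar ≤ j →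
      ∃ 𝔸 : ℕ → A, 𝔸 j = iso (kbar j) ∧
        (∀ m, mstar ≤ m → m ≤ j → NI (𝔸 m) (kbar m * alo) (kbar m * ahi)) ∧
        ∀ m, mstar ≤ m → m < j → ∀ w₀ : V, Dat w₀ → Cls R w₀ →
          (∃ v, Sol m (𝔸 m) w₀ v) ∧
          ∀ u v : ℝ → V, Sol (m + 1) (𝔸 (m + 1)) w₀ u → Sol m (𝔸 m) w₀ v →
            ∀ᶠ t in L,
              0 ≤ dr w₀ v t ∧
              (1 - C * ((N m : ℝ) / N (m + 1)) ^ σ) * dr w₀ v t ≤ dr w₀ u t) :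
    ∃ a > (0:ℝ), ∀ R : ℝ≥0, ∃ mstar : ℕ, ∃ θ > (0:ℝ), ∃ j₁ : ℕ, ∀ j ≥ j₁,
      ∃ 𝔸s : A, ∃ hi : ℝ, NI 𝔸s (kbar mstar * a) hi ∧
        ∀ (w₀ : V) (u : ℝ → V), Dat w₀ → Cls R w₀ → Sol j (iso (kbar j)) w₀ u →
          ∃ v, Sol mstar 𝔸s w₀ v ∧ ∀ᶠ t in L, θ * dr w₀ v t ≤ dr w₀ u t := by
  obtain ⟨alo, halo, ahi, C, hC, σ, hσ, hR⟩ := hCh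
  refine ⟨alo, halo, fun R => ?_⟩
  obtain ⟨mstar, hm⟩ := hR R
  -- the one-level error `x m = C ρ_m^σ` is dominated by the geometric sequence `C r^m`, `r = (1/2)^σ < 1`
  set x : ℕ → ℝ := fun m => C * ((N m : ℝ) / N (m + 1)) ^ σ with hx_def
  set r : ℝ := (1 / 2 : ℝ) ^ σ with hr_def
  have hr0 : 0 < r := Real.rpow_pos_of_pos (by norm_num) σ
  have hr1 : r < 1 := Real.rpow_lt_one (by norm_num) (by norm_num) hσ
  have hρ0 : ∀ m, 0 ≤ (N m : ℝ) / N (m + 1) := fun m => by positivity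
  have hx0 : ∀ m, 0 ≤ x m := fun m => by
    simp only [hx_def]
    exact mul_nonneg hC.le (Real.rpow_nonneg (hρ0 m) σ)
  have hxr : ∀ m, x m ≤ C * r ^ m := fun m => by
    simp only [hx_def, hr_def]
    refine mul_le_mul_of_nonneg_left ?_ hC.le
    calc ((N m : ℝ) / N (m + 1)) ^ σ ≤ ((1 / 2 : ℝ) ^ m) ^ σ :=
          Real.rpow_le_rpow (hρ0 m) (ratio_le_half_pow hN h2 hsq m) hσ.le
      _ = ((1 / 2 : ℝ) ^ σ) ^ m := by
          rw [← Real.rpow_natCast, ← Real.rpow_mul (by norm_num), mul_comm, Real.rpow_mul (by norm_num),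
            Real.rpow_natCast]
  -- raise the base level until the tail of the errors is at most `1/2`
  obtain ⟨M₀, hM₀⟩ : ∃ M₀ : ℕ, C * r ^ M₀ ≤ (1 - r) / 2 := by
    have ht : Tendsto (fun n : ℕ => C * r ^ n) atTop (nhds (C * 0)) :=
      (tendsto_pow_atTop_nhds_zero_of_lt_one hr0.le hr1).const_mul C
    rw [mul_zero] at ht
    have hpos : (0 : ℝ) < (1 - r) / 2 := by linarith
    exact (ht.eventually (ge_mem_nhds hpos)).exists
  set M : ℕ := max mstar M₀ with hM_def
  have hMm : mstar ≤ M := le_max_left _ _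
  have hMM₀ : M₀ ≤ M := le_max_right _ _
  -- every error from level `M` on is at most `1/2`, and their partial sums stay below `1/2`
  have hx_half : ∀ m, M ≤ m → x m ≤ 1 / 2 := fun m hMle => by
    have h1 : r ^ m ≤ r ^ M₀ := pow_le_pow_of_le_one hr0.le hr1.le (le_trans hMM₀ hMle)
    have := hxr m
    nlinarith [hC]
  have hsum_half : ∀ n, ∑ i ∈ Finset.range n, x (M + i) ≤ 1 / 2 := fun n => by
    have hgeom : ∑ i ∈ Finset.range n, r ^ i ≤ (1 - r)⁻¹ := by
      have hs : Summable (fun i : ℕ => r ^ i) := summable_geometric_of_lt_one hr0.le hr1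
      calc ∑ i ∈ Finset.range n, r ^ i ≤ ∑' i : ℕ, r ^ i :=
            hs.sum_le_tsum (Finset.range n) (fun i _ => pow_nonneg hr0.le i)
        _ = (1 - r)⁻¹ := tsum_geometric_of_lt_one hr0.le hr1
    calc ∑ i ∈ Finset.range n, x (M + i) ≤ ∑ i ∈ Finset.range n, C * r ^ M * r ^ i := by
          refine Finset.sum_le_sum fun i _ => ?_
          calc x (M + i) ≤ C * r ^ (M + i) := hxr (M + i)
            _ = C * r ^ M * r ^ i := by rw [pow_add, mul_assoc]
      _ = C * r ^ M * ∑ i ∈ Finset.range n, r ^ i := by rw [Finset.mul_sum]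
      _ ≤ C * r ^ M * (1 - r)⁻¹ := mul_le_mul_of_nonneg_left hgeom (by positivity)
      _ ≤ C * r ^ M₀ * (1 - r)⁻¹ := by
          have h1 : r ^ M ≤ r ^ M₀ := pow_le_pow_of_le_one hr0.le hr1.le hMM₀
          have h2' : 0 < (1 - r)⁻¹ := inv_pos.mpr (by linarith)
          exact mul_le_mul_of_nonneg_right (mul_le_mul_of_nonneg_left h1 hC.le) h2'.le
      _ ≤ (1 - r) / 2 * (1 - r)⁻¹ := mul_le_mul_of_nonneg_right hM₀ (inv_pos.mpr (by linarith)).le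
      _ = 1 / 2 := by
          have hne : (1 - r) ≠ 0 := ne_of_gt (by linarith)
          calc (1 - r) / 2 * (1 - r)⁻¹ = ((1 - r) * (1 - r)⁻¹) / 2 := by ring
            _ = 1 / 2 := by rw [mul_inv_cancel₀ hne]
  refine ⟨M, 1 / 2, by norm_num, M + 1, fun j hj => ?_⟩
  obtain ⟨𝔸, h𝔸j, hNI, hstep⟩ := hm j (le_trans hMm (by omega))
  refine ⟨𝔸 M, kbar M * ahi, hNI M hMm (by omega), fun w₀ u hD hCl hu => ?_⟩
  -- descending induction: from a solution `n+1` levels above `m` to some level-`m` solution, compounding the lower ratios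
  have key : ∀ n m, M ≤ m → m + (n + 1) ≤ j → ∀ u' : ℝ → V, Sol (m + (n + 1)) (𝔸 (m + (n + 1))) w₀ u' →
      ∃ v, Sol m (𝔸 m) w₀ v ∧ ∀ᶠ t in L,
        0 ≤ dr w₀ v t ∧ (1 - ∑ i ∈ Finset.range (n + 1), x (m + i)) * dr w₀ v t ≤ dr w₀ u' t := by
    intro n
    induction n with
    | zero =>
      intro m hMle hmj u' hu'
      obtain ⟨⟨v, hv⟩, hpair⟩ := hstep m (le_trans hMm hMle) (by omega) w₀ hD hCl
      refine ⟨v, hv, ?_⟩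
      have h := hpair u' v (by simpa using hu') hv
      refine h.mono fun t ht => ⟨ht.1, ?_⟩
      simpa [hx_def] using ht.2
    | succ n ih =>
      intro m hMle hmj u' hu'
      -- one chain step at level `m + (n+1)`
      have e : m + (n + 1 + 1) = m + (n + 1) + 1 := by omega
      rw [e] at hu'
      obtain ⟨⟨v', hv'⟩, hpair⟩ := hstep (m + (n + 1)) (le_trans (le_trans hMm hMle) (by omega)) (by omega) w₀ hD hCl
      have hone := hpair u' v' hu' hv'
      -- the induction hypothesis from `v'`
      obtain ⟨v, hv, hih⟩ := ih m hMle (by omega) v' hv'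
      refine ⟨v, hv, (hone.and hih).mono fun t ht => ⟨ht.2.1, ?_⟩⟩
      obtain ⟨⟨_, hlow⟩, hvnn, hsumle⟩ := ht
      have hxle : x (m + (n + 1)) ≤ 1 / 2 := hx_half _ (by omega)
      have hxnn : 0 ≤ x (m + (n + 1)) := hx0 _
      have hfac : 0 ≤ 1 - x (m + (n + 1)) := by linarith
      have hSnn : 0 ≤ ∑ i ∈ Finset.range (n + 1), x (m + i) := Finset.sum_nonneg fun i _ => hx0 _
      have hlow' : (1 - x (m + (n + 1))) * dr w₀ v' t ≤ dr w₀ u' t := by simpa [hx_def] using hlow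
      have hmid : (1 - x (m + (n + 1))) * ((1 - ∑ i ∈ Finset.range (n + 1), x (m + i)) * dr w₀ v t) ≤
          (1 - x (m + (n + 1))) * dr w₀ v' t := mul_le_mul_of_nonneg_left hsumle hfac
      rw [Finset.sum_range_succ]
      have hcross : 0 ≤ x (m + (n + 1)) * (∑ i ∈ Finset.range (n + 1), x (m + i)) * dr w₀ v t :=
        mul_nonneg (mul_nonneg hxnn hSnn) hvnn
      nlinarith [hmid, hlow', hcross]
  -- apply it between the top level `j = M + (n+1)` and the base level `M`
  obtain ⟨n, rfl⟩ : ∃ n, j = M + (n + 1) := ⟨j - M - 1, by omega⟩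
  rw [← h𝔸j] at hu
  obtain ⟨v, hv, hfin⟩ := key n M le_rfl le_rfl u hu
  refine ⟨v, hv, hfin.mono fun t ht => ?_⟩
  obtain ⟨hvnn, hsumle⟩ := ht
  have hP : 1 / 2 ≤ 1 - ∑ i ∈ Finset.range (n + 1), x (M + i) := by
    have hS := hsum_half (n + 1)
    linarith
  calc 1 / 2 * dr w₀ v t ≤ (1 - ∑ i ∈ Finset.range (n + 1), x (M + i)) * dr w₀ v t :=
        mul_le_mul_of_nonneg_right hP hvnn
    _ ≤ dr w₀ u t := hsumle

/-- **The registered `stub_cascadeT` from the LOWER chain** (proposed v18 form `ChainLower E → Cascade E`). -/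
theorem cascade_of_chainLower {k : ℕ} (E : LatticeShear.LagrangianLatticeCarrier k) (hP : E.LPermissible)
    (hsq : ∀ m, E.N m ^ 2 ≤ E.N (m + 1)) (hCh : ChainLower E) : Cascade E :=
  cascade_of_chainLower_abstract
    (fun m 𝔸 w₀ u => TSol E m 𝔸 w₀ u) Torus.NearIso Torus.isoVisc IsDatum InClass
    E.kbar E.N drop (ae (volume.restrict (Ioo (1/2 : ℝ) 1)))
    E.N_pos hP.permissible.2.2.1 hsq hCh

/-- For the record: the registered two-sided `Chain E` also gives the cascade through the lower path. -/
theorem cascade_of_chain' {k : ℕ} (E : LatticeShear.LagrangianLatticeCarrier k) (hP : E.LPermissible)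
    (hsq : ∀ m, E.N m ^ 2 ≤ E.N (m + 1)) (hCh : Chain E) : Cascade E :=
  cascade_of_chainLower E hP hsq (chainLower_of_chain E hCh)


/-- **`ChainLower E` from the pieces** — `LagrangianStep.chain_of_pieces` VERBATIM for the one-sided one-level step: `hone` is the
proposed v18 statement of `stub_oneLevelL` (every binder of v17 kept; conclusion = existence ∧ LOWER a.e. drop ratio only). -/
theorem chainLower_of_pieces
    (hba : ∀ k (E : LatticeShear.LagrangianLatticeCarrier k), E.LPermissible → E.Regular →
    ∀ (m : ℕ) (𝔸 : Torus.Visc4 (Fin 3)) (lo hi : ℝ), 0 < lo → Torus.NearIso 𝔸 lo hi →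
      ∀ (w₀ : VF) (u : ℝ → VF), IsDatum w₀ → TSol E m 𝔸 w₀ u →
        ∀ᵐ t ∂(volume.restrict (Ioo (1/2 : ℝ) 1)),
          (1 - Real.exp (-(4 * Real.pi ^ 2 * lo))) * Torus.vectorL2Sq w₀ ≤ drop w₀ u t)
    (hone : ∀ k (W : Literature.Analysis.FluidPDE.LatticeShear.LatticeWord k) (M : ℝ) (hM : 0 < M) (c : ℝ), 0 < c →
    ∀ (Φ : Torus.Visc4 (Fin 3) → Torus.Visc4 (Fin 3)) (lo hi Λ β σ C ν₀ K Cf νf Kf : ℝ),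
      0 < lo → lo ≤ 1 → 1 ≤ hi → 1 < Λ → 0 ≤ β → WindowClause Φ lo hi Λ β →
      0 < σ → 0 ≤ C → 0 < ν₀ → 0 < K → SlowVectorClause W M hM c Φ lo hi Λ β σ C ν₀ K →
      0 ≤ Cf → 0 < νf → 0 < Kf → CellEnergyClauses W M hM c lo hi Λ β Cf νf Kf →
      ∃ ν₁ > (0:ℝ), ∃ K₁ > (0:ℝ), ∃ Λ₀ : ℕ, ∃ θ₀ > (0:ℝ), ∃ C₁ > (0:ℝ), ∃ σ₁ > (0:ℝ),
        ∀ E : Literature.Analysis.FluidPDE.LatticeShear.LagrangianLatticeCarrier k, E.design = W.stretch M hM → E.gain = c → E.nu0 = ν₁ → E.K = K₁ → E.LPermissible → E.Regular → (∀ m, Λ₀ * E.N m ≤ E.N (m + 1)) → (∀ m, E.N m ^ 2 ≤ E.N (m + 1)) → (∀ m, E.cellVisc (m + 1) * ((E.N (m + 1) : ℝ) / E.N m) ^ (1 / 4 : ℝ) ≤ 1) → (∀ m, E.K * ((E.N (m + 1) : ℝ) / E.N m) ^ (1 / 4 : ℝ) ≤ ((E.N (m + 1) : ℝ) / E.N m)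 * E.cellVisc (m + 1)) → (∀ m, E.θ (m + 1) * ((E.N (m + 1) : ℝ) / E.N m) ^ (1 / 16 : ℝ) ≤ θ₀) → (∀ m, ((E.N (m + 1) : ℝ) / E.N m) ^ (1 / 16 : ℝ) * E.physPeriod (m + 1) ≤ E.refresh (m + 1)) →
        ∀ R : ℝ≥0, ∃ mstar : ℕ, ∀ m, mstar ≤ m →
          ∀ S : Torus.Visc4 (Fin 3), Torus.OddSmall S β → Torus.NearIso S lo hi →
          ∀ (w₀ : VF), IsDatum w₀ → InClass R w₀ →
          (∃ v, TSol E m (E.kbar m • renormStep Φ (E.gain / E.cellVisc (m + 1) ^ 2) S) w₀ v) ∧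
          ∀ u v : ℝ → VF, TSol E (m + 1) (E.kbar (m + 1) • S) w₀ u →
            TSol E m (E.kbar m • renormStep Φ (E.gain / E.cellVisc (m + 1) ^ 2) S) w₀ v →
            ∀ᵐ t ∂(volume.restrict (Ioo (1/2 : ℝ) 1)),
              (1 - C₁ * ((E.N m : ℝ) / E.N (m + 1)) ^ σ₁) * drop w₀ v t ≤ drop w₀ u t) :
    ∀ k (W : Literature.Analysis.FluidPDE.LatticeShear.LatticeWord k) (M : ℝ) (hM : 0 < M) (c : ℝ), 0 < c →
    ∀ (Φ : Torus.Visc4 (Fin 3) → Torus.Visc4 (Fin 3)) (lo hi Λ β σ C ν₀ K Cf νf Kf : ℝ),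
      0 < lo → lo ≤ 1 → 1 ≤ hi → 1 < Λ → 0 ≤ β → WindowClause Φ lo hi Λ β →
      0 < σ → 0 ≤ C → 0 < ν₀ → 0 < K → SlowVectorClause W M hM c Φ lo hi Λ β σ C ν₀ K →
      0 ≤ Cf → 0 < νf → 0 < Kf → CellEnergyClauses W M hM c lo hi Λ β Cf νf Kf →
      ∃ ν₁ > (0:ℝ), ∃ K₁ > (0:ℝ), ∃ Λ₀ : ℕ, ∃ θ₀ > (0:ℝ),
        ∀ E : Literature.Analysis.FluidPDE.LatticeShear.LagrangianLatticeCarrier k, E.design = W.stretch M hM → E.gain = c → E.nu0 = ν₁ → E.K = K₁ → E.LPermissible → E.Regular → (∀ m, Λ₀ * E.N m ≤ E.N (m + 1)) → (∀ m, E.N m ^ 2 ≤ E.N (m + 1)) → (∀ m, E.cellVisc (m + 1) * ((E.N (m + 1) : ℝ) / E.N m) ^ (1 / 4 : ℝ) ≤ 1) → (∀ m, E.K * ((E.N (m + 1) : ℝ) / E.N m) ^ (1 / 4 : ℝ) ≤ ((E.N (m + 1) : ℝ) / E.N m) * E.cellVisc (m + 1)) → (∀ m, E.θ (m + 1) * ((E.N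 (m + 1) : ℝ) / E.N m) ^ (1 / 16 : ℝ) ≤ θ₀) → (∀ m, ((E.N (m + 1) : ℝ) / E.N m) ^ (1 / 16 : ℝ) * E.physPeriod (m + 1) ≤ E.refresh (m + 1)) → ChainLower E := by
  intro k W M hM c hc Φ lo hi Λ β σ C ν₀ K Cf νf Kf hlo hlo1 hhi1 hΛ hβ hwin hσ hC hν₀ hK hV hCf hνf hKf hEcl
  obtain ⟨ν₁, hν₁, K₁, hK₁, Λ₀, θ₀, hθ₀, C₁, hC₁, σ₁, hσ₁, hlev⟩ :=
    hone k W M hM c hc Φ lo hi Λ β σ C ν₀ K Cf νf Kf hlo hlo1 hhi1 hΛ hβ hwin hσ hC hν₀ hK hV hCf hνf hKf hEcl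
  refine ⟨ν₁, hν₁, K₁, hK₁, Λ₀, θ₀, hθ₀, ?_⟩
  intro E hW hg hn hK' hP hR h1a h1b h2 h3 h4 h5
  have hlevE := hlev E hW hg hn hK' hP hR h1a h1b h2 h3 h4 h5
  have hgpos : ∀ i, 0 ≤ E.gain / E.cellVisc i ^ 2 := fun i => div_nonneg E.gain_pos.le (sq_nonneg _)
  have hwinS : ∀ j d, Torus.OddSmall (shapeSeq Φ (fun i => E.gain / E.cellVisc i ^ 2) j d) β ∧
      Torus.NearIso (shapeSeq Φ (fun i => E.gain / E.cellVisc i ^ 2) j d) lo hi :=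
    fun j d => shapeSeq_window hlo1 hhi1 hΛ.le hβ hwin hgpos j d
  have hwinT : ∀ j m, Torus.NearIso (chainTensor E Φ j m) (E.kbar m * lo) (E.kbar m * hi) :=
    fun j m => ((hwinS j (j - m)).2).smul (E.kbar_pos m).le
  refine ⟨lo, hlo, hi, C₁, hC₁, σ₁, hσ₁, ?_⟩
  intro R
  obtain ⟨mstar, hm⟩ := hlevE R
  refine ⟨mstar, fun j hj => ⟨chainTensor E Φ j, chainTensor_top E Φ j, fun m _ _ => hwinT j m, ?_⟩⟩
  intro m hm1 hm2 w₀ hdat hcl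
  have hstep := hm m hm1 (shapeSeq Φ (fun i => E.gain / E.cellVisc i ^ 2) j (j - (m + 1)))
    (hwinS j (j - (m + 1))).1 (hwinS j (j - (m + 1))).2 w₀ hdat hcl
  refine ⟨?_, ?_⟩
  · rw [chainTensor_succ E Φ hm2]
    exact hstep.1
  intro u v hu hv
  have hv' := hv
  rw [chainTensor_succ E Φ hm2] at hv'
  have hu' : TSol E (m + 1) (E.kbar (m + 1) • shapeSeq Φ (fun i => E.gain / E.cellVisc i ^ 2) j (j - (m + 1))) w₀ u := hu
  have hcmp := hstep.2 u v hu' hv'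
  have hbase := hba k E hP hR m (chainTensor E Φ j m) (E.kbar m * lo) (E.kbar m * hi)
    (mul_pos (E.kbar_pos m) hlo) (hwinT j m) w₀ v hdat hv
  have hcb : 0 ≤ 1 - Real.exp (-(4 * Real.pi ^ 2 * (E.kbar m * lo))) := by
    have hexp : Real.exp (-(4 * Real.pi ^ 2 * (E.kbar m * lo))) < 1 := by
      rw [Real.exp_lt_one_iff]
      have : 0 < 4 * Real.pi ^ 2 * (E.kbar m * lo) := by
        have := E.kbar_pos m
        positivity
      linarith
    linarith
  have hL2 : 0 ≤ Torus.vectorL2Sq w₀ := by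
    show 0 ≤ ∫ x, ‖w₀ x‖ ^ 2
    exact integral_nonneg fun x => by positivity
  filter_upwards [hcmp, hbase] with t h1 h2
  exact ⟨le_trans (mul_nonneg hcb hL2) h2, h1⟩


/-! ## Existence of the renormalised level-`m` problem (v19, F-p4g7-2; sorry-free; to be landed and replaced by an import) -/
section ExistsRenorm

open Function
open Literature.Analysis.FunctionSpaces.Torus (IsWeaklyDivFree)
open Literature.Analysis.FluidPDE.LatticeShear (LagrangianLatticeCarrier)
open Summit.AnomalousDissipation.AnomalousDissipation.Theorems.SolenoidalFractalHomogenisation.RealisedQuasiStaticCellLaw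
  (memLp_two_of_memSobolev_one_complexify)
open Summit.AnomalousDissipation.AnomalousDissipation.Theorems.SolenoidalFractalHomogenisation.LagrangianRenormalisationStep
  (memLp_top_stLift_of_continuous continuous_uncurry_partialSum isWeaklyDivFree_partialSum)

/-- **The missing lemma named in `PassiveVectorTensorLionsExistence`'s docstring.**  The renormalised level-`m` tensor
`c • renormStep Φ g S` is `NearIso (c·lo) (c·hi)` whenever `S` is in the `λ = 1` window, `g ≥ 0`, `c ≥ 0`. -/
theorem nearIso_smul_renormStep {Φ : FluidPDE.Torus.Visc4 (Fin 3) → FluidPDE.Torus.Visc4 (Fin 3)} {lo hi Λ β : ℝ}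
    (hΛ : 1 ≤ Λ) (hβ : 0 ≤ β) (hwin : WindowClause Φ lo hi Λ β) {g : ℝ} (hg : 0 ≤ g)
    {S : FluidPDE.Torus.Visc4 (Fin 3)} (hSo : FluidPDE.Torus.OddSmall S β) (hSn : FluidPDE.Torus.NearIso S lo hi)
    {c : ℝ} (hc : 0 ≤ c) :
    FluidPDE.Torus.NearIso (c • renormStep Φ g S) (c * lo) (c * hi) :=
  (renormStep_window hΛ hβ hwin hg hSo hSn).2.smul hc

/-- **Existence along the level-`m` partial sum for EVERY window tensor** (Lions): `E.Regular` (levels jointly continuous and weakly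
divergence free) and `NearIso 𝔸 lo hi`, `lo > 0`, give a weak solution `TSol E m 𝔸 w₀ u` on `(0,1)` for every `IsDatum w₀`.
[cite: LionsMagenes1972, Chap. 3 Thm. 1.1] -/
theorem existsL_tensor {k : ℕ} (E : LagrangianLatticeCarrier k) (hR : E.Regular) (m : ℕ)
    {𝔸 : FluidPDE.Torus.Visc4 (Fin 3)} {lo hi : ℝ} (h𝔸 : FluidPDE.Torus.NearIso 𝔸 lo hi) (hlo : 0 < lo)
    (w₀ : VF) (hw₀ : IsDatum w₀) : ∃ u, TSol E m 𝔸 w₀ u := by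
  have hc : ∀ i < m, Continuous (uncurry (E.b (i + 1))) := fun i _ => hR.levelRegular.continuous_uncurry_b i
  have hd : ∀ i < m, ∀ t, IsWeaklyDivFree (E.b (i + 1) t) := fun i _ t => hR.levelRegular.isWeaklyDivFree_b i t
  exact FluidPDE.Torus.exists_isWeakTensorPassiveVectorOn one_pos h𝔸 hlo
    (memLp_top_stLift_of_continuous (continuous_uncurry_partialSum E m hc) 1)
    (ae_of_all _ fun t => isWeaklyDivFree_partialSum E m hc hd t)
    (memLp_two_of_memSobolev_one_complexify hw₀.1) hw₀.2.2

/-- **The existence conjunct of `stub_oneLevelL`, proved.** -/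
theorem existsL_renorm {k : ℕ} (E : LagrangianLatticeCarrier k) (hR : E.Regular)
    {Φ : FluidPDE.Torus.Visc4 (Fin 3) → FluidPDE.Torus.Visc4 (Fin 3)} {lo hi Λ β : ℝ}
    (hlo : 0 < lo) (hΛ : 1 ≤ Λ) (hβ : 0 ≤ β) (hwin : WindowClause Φ lo hi Λ β) (hgain : 0 ≤ E.gain) (m : ℕ)
    {S : FluidPDE.Torus.Visc4 (Fin 3)} (hSo : FluidPDE.Torus.OddSmall S β) (hSn : FluidPDE.Torus.NearIso S lo hi)
    (w₀ : VF) (hw₀ : IsDatum w₀) :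
    ∃ v, TSol E m (E.kbar m • renormStep Φ (E.gain / E.cellVisc (m + 1) ^ 2) S) w₀ v :=
  existsL_tensor E hR m
    (nearIso_smul_renormStep hΛ hβ hwin (div_nonneg hgain (sq_nonneg _)) hSo hSn (E.kbar_pos m).le)
    (mul_pos (E.kbar_pos m) hlo) w₀ hw₀

/-- **ADAPTER v19 → v18.**  The proposed v19 statement of `stub_oneLevelL` (hypothesis: v18 with the existence conjunct deleted, all other
binders byte-identical) implies the registered v18 statement (conclusion), the existence being supplied by `existsL_renorm`. -/
theorem oneLevel_of_oneLevelNoExists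
    (hone : ∀ k (W : Literature.Analysis.FluidPDE.LatticeShear.LatticeWord k) (M : ℝ) (hM : 0 < M) (c : ℝ), 0 < c →
    ∀ (Φ : Torus.Visc4 (Fin 3) → Torus.Visc4 (Fin 3)) (lo hi Λ β σ C ν₀ K Cf νf Kf : ℝ),
      0 < lo → lo ≤ 1 → 1 ≤ hi → 1 < Λ → 0 ≤ β → WindowClause Φ lo hi Λ β →
      0 < σ → 0 ≤ C → 0 < ν₀ → 0 < K → SlowVectorClause W M hM c Φ lo hi Λ β σ C ν₀ K →
      0 ≤ Cf → 0 < νf → 0 < Kf → CellEnergyClauses W M hM c lo hi Λ β Cf νf Kf →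
      ∃ ν₁ > (0:ℝ), ∃ K₁ > (0:ℝ), ∃ Λ₀ : ℕ, ∃ θ₀ > (0:ℝ), ∃ C₁ > (0:ℝ), ∃ σ₁ > (0:ℝ),
        ∀ E : Literature.Analysis.FluidPDE.LatticeShear.LagrangianLatticeCarrier k, E.design = W.stretch M hM → E.gain = c → E.nu0 = ν₁ → E.K = K₁ → E.LPermissible → E.Regular → (∀ m, Λ₀ * E.N m ≤ E.N (m + 1)) → (∀ m, E.N m ^ 2 ≤ E.N (m + 1)) → (∀ m, E.cellVisc (m + 1) * ((E.N (m + 1) : ℝ) / E.N m) ^ (1 / 4 : ℝ) ≤ 1) → (∀ m, E.K * ((E.N (m + 1) : ℝ) / E.N m) ^ (1 / 4 : ℝ) ≤ ((E.N (m + 1) : ℝ) / E.N m) * E.cellVisc (m + 1)) → (∀ m, E.θ (m + 1) * ((E.N (m + 1) : ℝ) / E.N m) ^ (1 / 16 : ℝ) ≤ θ₀) → (∀ m, ((E.N (m + 1) : ℝ) / E.N m) ^ (1 / 16 : ℝ) * E.physPeriod (m + 1) ≤ E.refresh (m + 1)) →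
        ∀ R : ℝ≥0, ∃ mstar : ℕ, ∀ m, mstar ≤ m →
          ∀ S : Torus.Visc4 (Fin 3), Torus.OddSmall S β → Torus.NearIso S lo hi →
          ∀ (w₀ : VF), IsDatum w₀ → InClass R w₀ →
          ∀ u v : ℝ → VF, TSol E (m + 1) (E.kbar (m + 1) • S) w₀ u →
            TSol E m (E.kbar m • renormStep Φ (E.gain / E.cellVisc (m + 1) ^ 2) S) w₀ v →
            ∀ᵐ t ∂(volume.restrict (Ioo (1/2 : ℝ) 1)),
              (1 - C₁ * ((E.N m : ℝ) / E.N (m + 1)) ^ σ₁) * drop w₀ v t ≤ drop w₀ u t) :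
    ∀ k (W : Literature.Analysis.FluidPDE.LatticeShear.LatticeWord k) (M : ℝ) (hM : 0 < M) (c : ℝ), 0 < c →
    ∀ (Φ : Torus.Visc4 (Fin 3) → Torus.Visc4 (Fin 3)) (lo hi Λ β σ C ν₀ K Cf νf Kf : ℝ),
      0 < lo → lo ≤ 1 → 1 ≤ hi → 1 < Λ → 0 ≤ β → WindowClause Φ lo hi Λ β →
      0 < σ → 0 ≤ C → 0 < ν₀ → 0 < K → SlowVectorClause W M hM c Φ lo hi Λ β σ C ν₀ K →
      0 ≤ Cf → 0 < νf → 0 < Kf → CellEnergyClauses W M hM c lo hi Λ β Cf νf Kf →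
      ∃ ν₁ > (0:ℝ), ∃ K₁ > (0:ℝ), ∃ Λ₀ : ℕ, ∃ θ₀ > (0:ℝ), ∃ C₁ > (0:ℝ), ∃ σ₁ > (0:ℝ),
        ∀ E : Literature.Analysis.FluidPDE.LatticeShear.LagrangianLatticeCarrier k, E.design = W.stretch M hM → E.gain = c → E.nu0 = ν₁ → E.K = K₁ → E.LPermissible → E.Regular → (∀ m, Λ₀ * E.N m ≤ E.N (m + 1)) → (∀ m, E.N m ^ 2 ≤ E.N (m + 1)) → (∀ m, E.cellVisc (m + 1) * ((E.N (m + 1) : ℝ) / E.N m) ^ (1 / 4 : ℝ) ≤ 1) → (∀ m, E.K * ((E.N (m + 1) : ℝ) / E.N m) ^ (1 / 4 : ℝ) ≤ ((E.N (m + 1) : ℝ) / E.N m) * E.cellVisc (m + 1)) → (∀ m, E.θ (m + 1) * ((E.N (m + 1) : ℝ) / E.N m) ^ (1 / 16 : ℝ) ≤ θ₀) → (∀ m, ((E.N (m + 1) : ℝ) / E.N m) ^ (1 / 16 : ℝ) * E.physPeriod (m + 1) ≤ E.refresh (m + 1)) →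
        ∀ R : ℝ≥0, ∃ mstar : ℕ, ∀ m, mstar ≤ m →
          ∀ S : Torus.Visc4 (Fin 3), Torus.OddSmall S β → Torus.NearIso S lo hi →
          ∀ (w₀ : VF), IsDatum w₀ → InClass R w₀ →
          (∃ v, TSol E m (E.kbar m • renormStep Φ (E.gain / E.cellVisc (m + 1) ^ 2) S) w₀ v) ∧
          ∀ u v : ℝ → VF, TSol E (m + 1) (E.kbar (m + 1) • S) w₀ u →
            TSol E m (E.kbar m • renormStep Φ (E.gain / E.cellVisc (m + 1) ^ 2) S) w₀ v →
            ∀ᵐ t ∂(volume.restrict (Ioo (1/2 : ℝ) 1)),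
              (1 - C₁ * ((E.N m : ℝ) / E.N (m + 1)) ^ σ₁) * drop w₀ v t ≤ drop w₀ u t := by
  intro k W M hM c hc Φ lo hi Λ β σ C ν₀ K Cf νf Kf hlo hlo1 hhi1 hΛ hβ hwin hσ hC hν₀ hK hV hCf hνf hKf hEcl
  obtain ⟨ν₁, hν₁, K₁, hK₁, Λ₀, θ₀, hθ₀, C₁, hC₁, σ₁, hσ₁, hE⟩ :=
    hone k W M hM c hc Φ lo hi Λ β σ C ν₀ K Cf νf Kf hlo hlo1 hhi1 hΛ hβ hwin hσ hC hν₀ hK hV hCf hνf hKf hEcl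
  refine ⟨ν₁, hν₁, K₁, hK₁, Λ₀, θ₀, hθ₀, C₁, hC₁, σ₁, hσ₁, fun E hW hg hn hK' hP hR h1 h2 h3 h4 h5 h6 R => ?_⟩
  obtain ⟨mstar, hm⟩ := hE E hW hg hn hK' hP hR h1 h2 h3 h4 h5 h6 R
  refine ⟨mstar, fun m hmm S hSo hSn w₀ hD hCl => ⟨?_, hm m hmm S hSo hSn w₀ hD hCl⟩⟩
  have hgain : 0 ≤ E.gain := by rw [hg]; exact hc.le
  exact existsL_renorm E hR hlo hΛ.le hβ hwin hgain m hSo hSn w₀ hD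

end ExistsRenorm

/-! ## (V) without its existence conjunct (v20, F-p4g7-3; sorry-free; to be landed and replaced by an import) -/
section CellLawVNoEx

open Function
open Literature.Analysis.FluidPDE.LatticeShear (LagrangianLatticeCarrier LatticeWord)
open Summit.AnomalousDissipation.AnomalousDissipation.Theorems.SolenoidalFractalHomogenisation.RealisedQuasiStaticCellLaw
  (memLp_two_of_memSobolev_one_complexify memSobolev_one_singleMode isWeaklyDivFree_singleMode)

/-- The SLOW-VECTOR clause WITHOUT its existence conjunct (`SlowVectorClause` verbatim otherwise). -/
def SlowVectorClauseNoEx {k : ℕ} (W : LatticeShear.LatticeWord k) (M : ℝ) (hM : 0 < M) (c : ℝ)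
    (Φ : Torus.Visc4 (Fin 3) → Torus.Visc4 (Fin 3)) (lo hi Λ β σ C ν₀ K : ℝ) : Prop :=
      ∀ ν, ∀ hν : ν ∈ Set.Ioo 0 ν₀, ∀ n : ℕ, ∀ 𝔸 : Torus.Visc4 (Fin 3),
        Torus.OddSmall 𝔸 (ν * β) → (∃ lam ∈ Set.Icc (1:ℝ) Λ, Torus.NearIso 𝔸 (ν * (lo / lam)) (ν * (hi * lam))) →
        ∀ ℓ : Fin 3 → ℤ, ℓ ≠ 0 → ‖Torus.latticeVec ℓ‖ * (⌈K / ν⌉₊ : ℝ) ≤ n →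
        ∀ p : EuclideanSpace ℝ (Fin 3), ‖p‖ = 1 → ⟪p, Torus.latticeVec ℓ⟫_ℝ = 0 →
        ∀ T > (0:ℝ),
          ∀ w v : ℝ → VF,
            Torus.IsWeakTensorPassiveVectorOn 0 T ((1 / (n:ℝ) ^ 2) • 𝔸) (cellField W M hM ν hν.1 n) (fun x => (UnitAddTorus.mFourier ℓ x).re • p) w →
            Torus.IsWeakTensorPassiveVectorOn 0 (2 * T) ((1 / (n:ℝ) ^ 2) • (𝔸 + (c / ν) • Φ ((1 / ν) • 𝔸))) (fun _ _ => 0)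
                (fun x => (UnitAddTorus.mFourier ℓ x).re • p) v →
            ∀ᵐ t ∂(volume.restrict (Ioo 0 T)),
              2 * ∑ i, ‖modeCoeff ℓ (fun x => w t x - v t x) i‖ ^ 2
                  ≤ (C * (C * (ν ^ σ + (‖Torus.latticeVec ℓ‖ * (⌈K / ν⌉₊ : ℝ) / n) ^ σ) * min 1 ((8 * Real.pi ^ 2 * ‖Torus.latticeVec ℓ‖ ^ 2 * (hi * Λ) * (ν + c / ν) / (n:ℝ) ^ 2) * t) + (8 * Real.pi ^ 2 * ‖Torus.latticeVec ℓ‖ ^ 2 * (hi * Λ) * (ν + c / ν) / (n:ℝ) ^ 2) * (M * W.period / ν))) ^ 2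
                      * ∫ x, ‖(UnitAddTorus.mFourier ℓ x).re • p‖ ^ 2

/-- A non-zero lattice vector has positive norm. [folklore] -/
theorem norm_latticeVec_pos {ℓ : Fin 3 → ℤ} (hℓ : ℓ ≠ 0) : 0 < ‖Torus.latticeVec ℓ‖ := by
  refine norm_pos_iff.2 fun h => hℓ ?_
  funext i
  have hi := congrArg (fun v : EuclideanSpace ℝ (Fin 3) => v i) h
  simp only [Torus.latticeVec_apply, PiLp.zero_apply] at hi
  exact_mod_cast hi

/-- `ℓ ≠ 0` and the slow-band condition `‖ℓ‖·⌈K/ν⌉ ≤ n` (`K, ν > 0`) force `1 ≤ n`. -/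
theorem one_le_of_slowBand {ℓ : Fin 3 → ℤ} (hℓ : ℓ ≠ 0) {K ν : ℝ} (hK : 0 < K) (hν : 0 < ν) {n : ℕ}
    (h : ‖Torus.latticeVec ℓ‖ * (⌈K / ν⌉₊ : ℝ) ≤ n) : 1 ≤ (n:ℝ) := by
  have h1 : (1:ℝ) ≤ ⌈K / ν⌉₊ := by exact_mod_cast Nat.one_le_iff_ne_zero.mpr (Nat.pos_iff_ne_zero.mp (Nat.ceil_pos.mpr (div_pos hK hν)))
  have h2 : 0 < ‖Torus.latticeVec ℓ‖ := norm_latticeVec_pos hℓ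
  -- `‖latticeVec ℓ‖ ≥ 1` for a non-zero integer vector: some coordinate has `|ℓ i| ≥ 1`
  have h3 : (1:ℝ) ≤ ‖Torus.latticeVec ℓ‖ := by
    obtain ⟨i, hi⟩ : ∃ i, ℓ i ≠ 0 := by
      by_contra hc
      push Not at hc
      exact hℓ (funext hc)
    have hcoord : |(Torus.latticeVec ℓ) i| ≤ ‖Torus.latticeVec ℓ‖ := by
      have := EuclideanSpace.norm_eq (Torus.latticeVec ℓ)
      calc |(Torus.latticeVec ℓ) i| = Real.sqrt (|(Torus.latticeVec ℓ) i| ^ 2) := by rw [Real.sqrt_sq (abs_nonneg _)]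
        _ ≤ Real.sqrt (∑ j, ‖(Torus.latticeVec ℓ) j‖ ^ 2) := by
            apply Real.sqrt_le_sqrt
            rw [← Real.norm_eq_abs]
            exact Finset.single_le_sum (f := fun j => ‖(Torus.latticeVec ℓ) j‖ ^ 2) (fun j _ => sq_nonneg _) (Finset.mem_univ i)
        _ = ‖Torus.latticeVec ℓ‖ := this.symm
    have h1i : (1:ℝ) ≤ |(Torus.latticeVec ℓ) i| := by
      rw [Torus.latticeVec_apply]
      have hz : ((1:ℤ) : ℝ) ≤ ((|ℓ i| : ℤ) : ℝ) := by exact_mod_cast Int.one_le_abs hi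
      simpa [Int.cast_abs] using hz
    exact h1i.trans hcoord
  nlinarith

/-- **Ellipticity of the effective tensor from the window clause.**  For `𝔸` in the `ν`-scaled nested window and `n ≥ 1`, the effective cell
tensor `(1/n²)•(𝔸 + (c/ν)•Φ((1/ν)•𝔸))` is `NearIso` with the positive lower constant `(1/n²)·(ν + c/ν)·(lo/λ)`. -/
theorem nearIso_effTensor {Φ : FluidPDE.Torus.Visc4 (Fin 3) → FluidPDE.Torus.Visc4 (Fin 3)} {lo hi Λ β : ℝ}
    (hwin : WindowClause Φ lo hi Λ β) {ν c : ℝ} (hν : 0 < ν) (hc : 0 ≤ c) {n : ℕ}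
    {𝔸 : FluidPDE.Torus.Visc4 (Fin 3)} (hodd : FluidPDE.Torus.OddSmall 𝔸 (ν * β))
    {lam : ℝ} (hlam : lam ∈ Set.Icc (1:ℝ) Λ) (hA : FluidPDE.Torus.NearIso 𝔸 (ν * (lo / lam)) (ν * (hi * lam))) :
    FluidPDE.Torus.NearIso ((1 / (n:ℝ) ^ 2) • (𝔸 + (c / ν) • Φ ((1 / ν) • 𝔸)))
      ((1 / (n:ℝ) ^ 2) * ((ν + c / ν) * (lo / lam))) ((1 / (n:ℝ) ^ 2) * ((ν + c / ν) * (hi * lam))) := by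
  have hν0 : ν ≠ 0 := hν.ne'
  -- the rescaled tensor `(1/ν)•𝔸` is in the unscaled window
  have hodd' : FluidPDE.Torus.OddSmall ((1 / ν) • 𝔸) β := by
    have h := hodd.smul (1 / ν)
    exact oddSmall_congr h (by field_simp)
  have hA' : FluidPDE.Torus.NearIso ((1 / ν) • 𝔸) (lo / lam) (hi * lam) := by
    have h := hA.smul (c := 1 / ν) (by positivity)
    exact nearIso_congr h (by field_simp) (by field_simp)
  obtain ⟨_, hΦ⟩ := hwin lam hlam ((1 / ν) • 𝔸) hodd' hA'
  have hcν : 0 ≤ c / ν := div_nonneg hc hν.le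
  have hsum := hA.add (hΦ.smul hcν)
  have hn : (0:ℝ) ≤ 1 / (n:ℝ) ^ 2 := by positivity
  have h := hsum.smul hn
  exact nearIso_congr h (by ring) (by ring)

/-- **Existence of the effective single-mode solution** (the deleted conjunct), from the window clause and Lions' carrier-free theorem.
[cite: LionsMagenes1972, Chap. 3 Thm. 1.1] -/
theorem exists_effective_singleMode {Φ : FluidPDE.Torus.Visc4 (Fin 3) → FluidPDE.Torus.Visc4 (Fin 3)} {lo hi Λ β : ℝ}
    (hlo : 0 < lo) (hwin : WindowClause Φ lo hi Λ β) {ν c K : ℝ} (hν : 0 < ν) (hc : 0 ≤ c) (hK : 0 < K) {n : ℕ}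
    {𝔸 : FluidPDE.Torus.Visc4 (Fin 3)} (hodd : FluidPDE.Torus.OddSmall 𝔸 (ν * β))
    (hwin' : ∃ lam ∈ Set.Icc (1:ℝ) Λ, FluidPDE.Torus.NearIso 𝔸 (ν * (lo / lam)) (ν * (hi * lam)))
    {ℓ : Fin 3 → ℤ} (hℓ : ℓ ≠ 0) (hsep : ‖Torus.latticeVec ℓ‖ * (⌈K / ν⌉₊ : ℝ) ≤ n)
    {p : EuclideanSpace ℝ (Fin 3)} (hperp : ⟪p, Torus.latticeVec ℓ⟫_ℝ = 0) {T : ℝ} (hT : 0 < T) :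
    ∃ v : ℝ → VF, FluidPDE.Torus.IsWeakTensorPassiveVectorOn 0 (2 * T) ((1 / (n:ℝ) ^ 2) • (𝔸 + (c / ν) • Φ ((1 / ν) • 𝔸))) (fun _ _ => 0)
      (fun x => (UnitAddTorus.mFourier ℓ x).re • p) v := by
  obtain ⟨lam, hlam, hA⟩ := hwin'
  have hN := nearIso_effTensor (n := n) hwin hν hc hodd hlam hA
  have hn1 : 1 ≤ (n:ℝ) := one_le_of_slowBand hℓ hK hν hsep
  have hlam1 : 0 < lam := lt_of_lt_of_le one_pos hlam.1
  have hlo' : 0 < (1 / (n:ℝ) ^ 2) * ((ν + c / ν) * (lo / lam)) := by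
    have : 0 < ν + c / ν := by positivity
    positivity
  exact FluidPDE.Torus.exists_isWeakTensorPassiveVectorOn_zero_carrier (by linarith) hN hlo'
    (memLp_two_of_memSobolev_one_complexify (memSobolev_one_singleMode ℓ p)) (isWeaklyDivFree_singleMode ℓ hperp)

/-- **(V) without existence ⇒ (V).** -/
theorem slowVectorClause_of_noEx {k : ℕ} {W : LatticeWord k} {M : ℝ} {hM : 0 < M} {c : ℝ}
    {Φ : FluidPDE.Torus.Visc4 (Fin 3) → FluidPDE.Torus.Visc4 (Fin 3)} {lo hi Λ β σ C ν₀ K : ℝ}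
    (hc : 0 < c) (hlo : 0 < lo) (hK : 0 < K) (hwin : WindowClause Φ lo hi Λ β)
    (h : SlowVectorClauseNoEx W M hM c Φ lo hi Λ β σ C ν₀ K) : SlowVectorClause W M hM c Φ lo hi Λ β σ C ν₀ K := by
  intro ν hν n 𝔸 hodd hwin' ℓ hℓ hsep p hp hperp T hT
  exact ⟨exists_effective_singleMode hlo hwin hν.1 hc.le hK hodd hwin' hℓ hsep hperp hT,
    h ν hν n 𝔸 hodd hwin' ℓ hℓ hsep p hp hperp T hT⟩

/-- **ADAPTER v20 → registered.**  The proposed statement of `stub_cellLawV` (conclusion ending in `SlowVectorClauseNoEx`) implies the registered one. -/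
theorem cellLawV_of_cellLawVNoEx
    (hV : ∀ k (W : Literature.Analysis.FluidPDE.LatticeShear.LatticeWord k) (c₀ : ℝ), 0 < c₀ →
    Literature.Analysis.FluidPDE.LatticeShear.IsotropicWordGain W c₀ → ScalarLawBlock W c₀ →
    ∃ M : ℝ, ∃ hM : 0 < M, ∃ c > (0:ℝ), ∃ Φ : FluidPDE.Torus.Visc4 (Fin 3) → FluidPDE.Torus.Visc4 (Fin 3),
      ∃ lo > (0:ℝ), ∃ hi : ℝ, lo ≤ 1 ∧ 1 ≤ hi ∧ ∃ Λ > (1:ℝ), ∃ β ≥ (0:ℝ), WindowClause Φ lo hi Λ β ∧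
      ∃ σ > (0:ℝ), ∃ C : ℝ, 0 ≤ C ∧ ∃ ν₀ > (0:ℝ), ∃ K > (0:ℝ), SlowVectorClauseNoEx W M hM c Φ lo hi Λ β σ C ν₀ K) :
    ∀ k (W : Literature.Analysis.FluidPDE.LatticeShear.LatticeWord k) (c₀ : ℝ), 0 < c₀ →
    Literature.Analysis.FluidPDE.LatticeShear.IsotropicWordGain W c₀ → ScalarLawBlock W c₀ →
    ∃ M : ℝ, ∃ hM : 0 < M, ∃ c > (0:ℝ), ∃ Φ : FluidPDE.Torus.Visc4 (Fin 3) → FluidPDE.Torus.Visc4 (Fin 3),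
      ∃ lo > (0:ℝ), ∃ hi : ℝ, lo ≤ 1 ∧ 1 ≤ hi ∧ ∃ Λ > (1:ℝ), ∃ β ≥ (0:ℝ), WindowClause Φ lo hi Λ β ∧
      ∃ σ > (0:ℝ), ∃ C : ℝ, 0 ≤ C ∧ ∃ ν₀ > (0:ℝ), ∃ K > (0:ℝ), SlowVectorClause W M hM c Φ lo hi Λ β σ C ν₀ K := by
  intro k W c₀ hc₀ hG hS
  obtain ⟨M, hM, c, hc, Φ, lo, hlo, hi, hlo1, hhi1, Λ, hΛ, β, hβ, hwin, σ, hσ, C, hC, ν₀, hν₀, K, hK, hV'⟩ := hV k W c₀ hc₀ hG hS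
  exact ⟨M, hM, c, hc, Φ, lo, hlo, hi, hlo1, hhi1, Λ, hΛ, β, hβ, hwin, σ, hσ, C, hC, ν₀, hν₀, K, hK,
    slowVectorClause_of_noEx hc hlo hK hwin hV'⟩

end CellLawVNoEx

/-! ## (F) without its energy-inequality conjunct (v21, F-p4g7-4; sorry-free; to be landed and replaced by an import) -/
section CellEnergyTNoE

open Function
open Literature.Analysis.FunctionSpaces.Torus (stLift)
open Literature.Analysis.FluidPDE.LatticeShear (LagrangianLatticeCarrier LatticeWord)
open Summit.AnomalousDissipation.AnomalousDissipation.Theorems.SolenoidalFractalHomogenisation.RealisedQuasiStaticCellLaw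
  (memLp_two_of_memSobolev_one_complexify memLp_top_stLift_cell)

/-- The CELL-ENERGY clauses WITHOUT the energy-inequality conjunct of (F) (`CellEnergyClauses` verbatim otherwise). -/
def CellEnergyClausesNoE {k : ℕ} (W : LatticeShear.LatticeWord k) (M : ℝ) (hM : 0 < M) (c : ℝ) (lo hi Λ β C ν₀ K : ℝ) : Prop :=
      ∀ ν, ∀ hν : ν ∈ Set.Ioo 0 ν₀, ∀ n : ℕ, ∀ 𝔸 : Torus.Visc4 (Fin 3),
        Torus.OddSmall 𝔸 (ν * β) → (∃ lam ∈ Set.Icc (1:ℝ) Λ, Torus.NearIso 𝔸 (ν * (lo / lam)) (ν * (hi * lam))) →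
        (∀ L > (0:ℝ), L * (⌈K / ν⌉₊ : ℝ) ≤ n → ∀ F : VF, IsDatum F →
            (∀ k' : Fin 3 → ℤ, ‖Torus.latticeVec k'‖ < (n:ℝ) / 2 → ∀ i, modeCoeff k' F i = 0) →
            ∀ T > (0:ℝ), ∀ u : ℝ → VF, Torus.IsWeakTensorPassiveVectorOn 0 T ((1 / (n:ℝ) ^ 2) • 𝔸) (cellField W M hM ν hν.1 n) F u →
              ∀ᵐ t ∂(volume.restrict (Ioo 0 T)),
                lowEnergy L (u t) ≤ C * (c * L ^ 2 / ((n:ℝ) ^ 2 * ν ^ 2)) * ∫ x, ‖F x‖ ^ 2) ∧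
        ∀ ℓ : Fin 3 → ℤ, ℓ ≠ 0 → ‖Torus.latticeVec ℓ‖ * (⌈K / ν⌉₊ : ℝ) ≤ n →
        ∀ p : EuclideanSpace ℝ (Fin 3), ‖p‖ = 1 → ⟪p, Torus.latticeVec ℓ⟫_ℝ = 0 →
        ∀ T > (0:ℝ), ∀ w : ℝ → VF,
            Torus.IsWeakTensorPassiveVectorOn 0 T ((1 / (n:ℝ) ^ 2) • 𝔸) (cellField W M hM ν hν.1 n) (fun x => (UnitAddTorus.mFourier ℓ x).re • p) w →
            ∀ᵐ t ∂(volume.restrict (Ioo 0 T)),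
              ∫ x, ‖w t x‖ ^ 2 - lowEnergy ((n:ℝ) / 2) (w t)
                  ≤ C * (c * ‖Torus.latticeVec ℓ‖ ^ 2 / ((n:ℝ) ^ 2 * ν ^ 2)) * ∫ x, ‖(UnitAddTorus.mFourier ℓ x).re • p‖ ^ 2

/-- **Energy inequality for every weak cell solution** (the deleted conjunct): window ellipticity + bounded continuous cell carrier + `L²`
divergence-free datum ⇒ `∫‖u t‖² ≤ ∫‖F‖²` for a.e. `t ∈ (0,T)`. [cite: Temam1984, Ch. III §1 Lemma 1.2] -/
theorem ae_energy_le_datum {k : ℕ} {W : LatticeWord k} {M : ℝ} {hM : 0 < M} {lo hi Λ : ℝ} (hlo : 0 < lo)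
    {ν : ℝ} (hν : 0 < ν) {n : ℕ} (hn : 1 ≤ (n:ℝ)) {𝔸 : FluidPDE.Torus.Visc4 (Fin 3)}
    (hwin' : ∃ lam ∈ Set.Icc (1:ℝ) Λ, FluidPDE.Torus.NearIso 𝔸 (ν * (lo / lam)) (ν * (hi * lam)))
    {F : VF} (hF : IsDatum F) {T : ℝ} {u : ℝ → VF}
    (hu : FluidPDE.Torus.IsWeakTensorPassiveVectorOn 0 T ((1 / (n:ℝ) ^ 2) • 𝔸) (cellField W M hM ν hν n) F u) :
    ∀ᵐ t ∂(volume.restrict (Ioo 0 T)), ∫ x, ‖u t x‖ ^ 2 ≤ ∫ x, ‖F x‖ ^ 2 := by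
  obtain ⟨lam, hlam, hA⟩ := hwin'
  have hlam1 : 0 < lam := lt_of_lt_of_le one_pos hlam.1
  have hN : FluidPDE.Torus.NearIso ((1 / (n:ℝ) ^ 2) • 𝔸) ((1 / (n:ℝ) ^ 2) * (ν * (lo / lam))) ((1 / (n:ℝ) ^ 2) * (ν * (hi * lam))) :=
    hA.smul (by positivity)
  have hlo' : 0 < (1 / (n:ℝ) ^ 2) * (ν * (lo / lam)) := by positivity
  have hb : MemLp (stLift (cellField W M hM ν hν n)) ∞ (volume.restrict (Ioo 0 T ×ˢ (univ : Set (EuclideanSpace ℝ (Fin 3))))) := by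
    unfold cellField
    exact memLp_top_stLift_cell _ n T
  have h := hu.ae_energy_ineq hN hlo' (memLp_two_of_memSobolev_one_complexify hF.1) hF.2.2 hb
  filter_upwards [h] with t ht
  have h1 : ENNReal.ofReal (∫ x, ‖u t x‖ ^ 2) ≤ ENNReal.ofReal (∫ x, ‖F x‖ ^ 2) := le_trans le_self_add ht
  exact (ENNReal.ofReal_le_ofReal_iff (integral_nonneg fun _ => by positivity)).1 h1

/-- `L > 0` and `L·⌈K/ν⌉ ≤ n` (`K, ν > 0`) force `1 ≤ n`. -/
theorem one_le_of_band {L K ν : ℝ} (hL : 0 < L) (hK : 0 < K) (hν : 0 < ν) {n : ℕ} (h : L * (⌈K / ν⌉₊ : ℝ) ≤ n) : 1 ≤ (n:ℝ) := by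
  have h1 : (1:ℝ) ≤ ⌈K / ν⌉₊ := by exact_mod_cast Nat.one_le_iff_ne_zero.mpr (Nat.pos_iff_ne_zero.mp (Nat.ceil_pos.mpr (div_pos hK hν)))
  have h2 : 0 < L * (⌈K / ν⌉₊ : ℝ) := by positivity
  have h3 : (0:ℝ) < n := lt_of_lt_of_le h2 h
  exact_mod_cast Nat.one_le_iff_ne_zero.mpr (by rintro rfl; simp at h3)

/-- **(C)+(F) without the energy conjunct ⇒ (C)+(F).** -/
theorem cellEnergyClauses_of_noE {k : ℕ} {W : LatticeWord k} {M : ℝ} {hM : 0 < M} {c : ℝ} {lo hi Λ β C ν₀ K : ℝ}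
    (hlo : 0 < lo) (hK : 0 < K) (h : CellEnergyClausesNoE W M hM c lo hi Λ β C ν₀ K) : CellEnergyClauses W M hM c lo hi Λ β C ν₀ K := by
  intro ν hν n 𝔸 hodd hwin'
  obtain ⟨hFcl, hCcl⟩ := h ν hν n 𝔸 hodd hwin'
  refine ⟨fun L hL hLn F hF hmodes T hT u hu => ?_, hCcl⟩
  have h1 := ae_energy_le_datum (hM := hM) hlo hν.1 (one_le_of_band hL hK hν.1 hLn) hwin' hF hu
  have h2 := hFcl L hL hLn F hF hmodes T hT u hu
  filter_upwards [h1, h2] with t ht1 ht2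
  exact ⟨ht1, ht2⟩

/-- **ADAPTER v21 → registered.**  The proposed statement of `stub_cellEnergyT` (conclusion `CellEnergyClausesNoE`) implies the registered one. -/
theorem cellEnergyT_of_cellEnergyTNoE
    (hT : ∀ k (W : Literature.Analysis.FluidPDE.LatticeShear.LatticeWord k) (M : ℝ) (hM : 0 < M) (c : ℝ), 0 < c →
    ∀ lo hi Λ β : ℝ, 0 < lo → lo ≤ 1 → 1 ≤ hi → 1 < Λ → 0 ≤ β →
      ∃ C : ℝ, 0 ≤ C ∧ ∃ ν₀ > (0:ℝ), ∃ K > (0:ℝ), CellEnergyClausesNoE W M hM c lo hi Λ β C ν₀ K) :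
    ∀ k (W : Literature.Analysis.FluidPDE.LatticeShear.LatticeWord k) (M : ℝ) (hM : 0 < M) (c : ℝ), 0 < c →
    ∀ lo hi Λ β : ℝ, 0 < lo → lo ≤ 1 → 1 ≤ hi → 1 < Λ → 0 ≤ β →
      ∃ C : ℝ, 0 ≤ C ∧ ∃ ν₀ > (0:ℝ), ∃ K > (0:ℝ), CellEnergyClauses W M hM c lo hi Λ β C ν₀ K := by
  intro k W M hM c hc lo hi Λ β hlo hlo1 hhi1 hΛ hβ
  obtain ⟨C, hC, ν₀, hν₀, K, hK, h⟩ := hT k W M hM c hc lo hi Λ β hlo hlo1 hhi1 hΛ hβ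
  exact ⟨C, hC, ν₀, hν₀, K, hK, cellEnergyClauses_of_noE hlo hK h⟩

end CellEnergyTNoE

/-! ## Registered stubs -/

/-- (M; DISCHARGED by name from p611352, ad-prover-2 g8, exactly as in the tenure seat's r22 v12 — statement byte-identical) Weak solutions of the top-level truncated problem exist for admissible data. -/
theorem stub_existsL : ∀ k (E : LatticeShear.LagrangianLatticeCarrier k), E.LPermissible → E.Regular →
    ∀ (m : ℕ) (w₀ : VF), IsDatum w₀ → ∃ u, TSol E m (Torus.isoVisc (E.kbar m)) w₀ u :=
  Summit.AnomalousDissipation.AnomalousDissipation.Theorems.SolenoidalFractalHomogenisation.LagrangianStep.stub_existsL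

/-- (M) Base: a coercive constant-tensor problem along a partial sum drops a fixed fraction of the energy by `t = 1/2`
(energy identity + Poincaré on mean-zero fields). -/
theorem stub_baseT : ∀ k (E : LatticeShear.LagrangianLatticeCarrier k), E.LPermissible → E.Regular →
    ∀ (m : ℕ) (𝔸 : Torus.Visc4 (Fin 3)) (lo hi : ℝ), 0 < lo → Torus.NearIso 𝔸 lo hi →
      ∀ (w₀ : VF) (u : ℝ → VF), IsDatum w₀ → TSol E m 𝔸 w₀ u →
        ∀ᵐ t ∂(volume.restrict (Ioo (1/2 : ℝ) 1)),
          (1 - Real.exp (-(4 * Real.pi ^ 2 * lo))) * Torus.vectorL2Sq w₀ ≤ drop w₀ u t :=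
  Summit.AnomalousDissipation.AnomalousDissipation.Theorems.SolenoidalFractalHomogenisation.LagrangianStep.stub_baseT

/-- (L) Tail (v16 re-cut of v3's additive form, RULING R23-1; v17: strain-budget ceiling `θs(k,W)`, see end of this docstring): the full carrier vs its truncation at the active level `j`, same viscosity `kbar j` — the
energy drops are `ε‖w₀‖²`-close for `j ≥ j₂(ε)`.  Mechanism: the omitted Lagrangian levels are `∇·ψ_{>j}` with an antisymmetric stream bivector (pushed-forward
Kolmogorov-layer potentials, `|ψ_m| ≤ ‖DX_{m-1}‖²_∞ · a m/(4π² N m²)`), and `‖ψ_{>j}‖_∞ / kbar j ≲ D(θ₀)² · sup_{m>j} cellVisc m / gain → 0` BY THE TEMPLATE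
HYPOTHESES NOW CARRIED (N² separation + (T2) ⇒ `cellVisc (m+1) ≤ (N m)^{-1/4}`; (T4) ⇒ `θ (m+1) ≤ θ₀` ⇒ window distortion `D(θ₀)` via
`Theorems/…LagrangianCarrierDistortion.lean`); the PDE half is the landed stream-form energy stability `ae_integral_norm_sq_le_add_of_stream`
(`Literature/…/PassiveVectorTensorStreamStability.lean`, p615321: `drop u ≤ drop w + (2η + η²)‖w₀‖²`, `η = 3‖ψ‖_∞/(2 kbar j)`).  From `LPermissible ∧ Regular`
alone the ratio is only bounded (constant `cellVisc` is Permissible), which is why v3–v15's cut was not provable as typed.  Only the one-sided consequence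
the composition needs is stated.  v17 (2026-08-28, after ideator p4 g6's finding F-p4g6-1 / K3L card `distortion-trapping-ceiling`): the uniform
window-distortion `D(θ₀)` of ALL levels above `j` is within reach of the norms-only frame recursion `d_m ≤ κ_k(1+D_{m−1})^p(1+C_{m−1})·strain_m` only under
a STRAIN-BUDGET CEILING (trapping region `{D, C ≤ ½}` iff `κ_k(3/2)^{p+1}·θ ≤ ½`; AV's absolute `2^{−25}`, arXiv:2305.05048 Prop. 2.2); so the stub now lets
the prover CHOOSE `θs = θs(k, W) > 0` (and `Λ₁`) per design and asks (T4) only for `θ₀ ≤ θs` — zero cost: the crux's `∃ θ₀ > 0` is the composition's choice,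
made at `min θ₀ θs` with `θ₀` from `stub_oneLevelL`. -/
theorem stub_tailL : ∀ k (W : Literature.Analysis.FluidPDE.LatticeShear.LatticeWord k), ∃ Λ₁ : ℕ, ∃ θs : ℝ, 0 < θs ∧
    ∀ (E : LatticeShear.LagrangianLatticeCarrier k), E.design = W → E.LPermissible → E.Regular →
    (∀ m, Λ₁ * E.N m ≤ E.N (m + 1)) → (∀ m, E.N m ^ 2 ≤ E.N (m + 1)) →
    (∀ m, E.cellVisc (m + 1) * ((E.N (m + 1) : ℝ) / E.N m) ^ (1 / 4 : ℝ) ≤ 1) →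
    ∀ θ₀ : ℝ, θ₀ ≤ θs → (∀ m, E.θ (m + 1) * ((E.N (m + 1) : ℝ) / E.N m) ^ (1 / 16 : ℝ) ≤ θ₀) →
    ∀ ε : ℝ, 0 < ε → ∃ j₂ : ℕ, ∀ j ≥ j₂, ∀ (w₀ : VF) (w u : ℝ → VF),
      IsDatum w₀ → FullSol E j w₀ w → TSol E j (Torus.isoVisc (E.kbar j)) w₀ u →
        ∀ᵐ t ∂(volume.restrict (Ioo (1/2 : ℝ) 1)), drop w₀ u t ≤ drop w₀ w t + ε * Torus.vectorL2Sq w₀ := by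
  sorry

/-- (XL; v10 re-cut of v9 `stub_cellLawT`, its Floquet–Bloch heart) The SLOW-VECTOR TENSOR CELL LAW from K1L's hypotheses: for the word `W`
isotropic with nominal constant `c₀` whose realised scalar law block holds, a pre-stretch `M`, a realised bookkeeping constant `c`, a normalised
LARGE-GAIN SHAPE MAP `Φ` with a nested family of `Φ`-invariant transverse windows (`WindowClause`: `{OddSmall β} ∩ {NearIso (lo/λ) (hi λ)}`,
`λ ∈ [1, Λ]` — finite-dimensional; satisfiable by ORDER-REVERSING monotonicity of the unnormalised excess map in the transverse Loewner order with
reciprocal bands `lo·hi ≈ 1`, not by one-step spectral contraction: the linearised shape map at the cubature word is non-normal, ‖L‖_W = 1.004,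
anisotropic spectral radius ≈ 0.634 — ad-ideate-p5 k1l-shape-map-spectrum; the odd-part guard `OddSmall` is load-bearing, F17-1) and constants
`σ, C, ν₀, K` with the slow-vector law (V) (`SlowVectorClause`: S1D's sector machinery with the transverse `2×2` symbol per wave vector — K2R's
Theorems chain is the template; amplitude DIFFERENCES from the same datum, decay-relative rate error, per-window burst term). -/
theorem stub_cellLawV : ∀ k (W : Literature.Analysis.FluidPDE.LatticeShear.LatticeWord k) (c₀ : ℝ), 0 < c₀ →
    Literature.Analysis.FluidPDE.LatticeShear.IsotropicWordGain W c₀ → ScalarLawBlock W c₀ →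
    ∃ M : ℝ, ∃ hM : 0 < M, ∃ c > (0:ℝ), ∃ Φ : Torus.Visc4 (Fin 3) → Torus.Visc4 (Fin 3),
      ∃ lo > (0:ℝ), ∃ hi : ℝ, lo ≤ 1 ∧ 1 ≤ hi ∧ ∃ Λ > (1:ℝ), ∃ β ≥ (0:ℝ), WindowClause Φ lo hi Λ β ∧
      ∃ σ > (0:ℝ), ∃ C : ℝ, 0 ≤ C ∧ ∃ ν₀ > (0:ℝ), ∃ K > (0:ℝ), SlowVectorClauseNoEx W M hM c Φ lo hi Λ β σ C ν₀ K := by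
  sorry

/-- (L; v10 re-cut of v9 `stub_cellLawT`, its energy half) The CELL-ENERGY CLAUSES for EVERY pre-stretch `M`, bookkeeping constant `c > 0` and
window `(lo, hi, Λ, β)`: constants `C, ν₀, K` (depending on `W, M, c` and the window) with (F) — cell-scale class data generate solutions along
the cell carrier with non-increasing energy (uniqueness for coercive constant tensors + bounded carriers, `PassiveVectorTensorUniqueness`
p607939, puts every weak solution in the energy class) whose slow energy `lowEnergy L` is `≤ C·(cL²/(n²ν²))·‖F‖²` (pairing with the adjoint slow
Floquet modes, whose cell-scale part has relative size `√e_f`) — and (C) — the corrector content of a slow-datum cell solution is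
`≤ C·(c|ℓ|²/(n²ν²))·E₀` (two-scale energy estimate; K2R's `CoupledModeEnergyBound` road). No shape map, no isotropy, no rate exponent. -/
theorem stub_cellEnergyT : ∀ k (W : Literature.Analysis.FluidPDE.LatticeShear.LatticeWord k) (M : ℝ) (hM : 0 < M) (c : ℝ), 0 < c →
    ∀ lo hi Λ β : ℝ, 0 < lo → lo ≤ 1 → 1 ≤ hi → 1 < Λ → 0 ≤ β →
      ∃ C : ℝ, 0 ≤ C ∧ ∃ ν₀ > (0:ℝ), ∃ K > (0:ℝ), CellEnergyClausesNoE W M hM c lo hi Λ β C ν₀ K := by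
  sorry

/-- (XL−; v10 — the two-scale heart of v9's `stub_chainL`, LOCAL in the level) ONE-LEVEL COMPARISON.  From the re-cut cell package (`Φ` with
its invariant windows; the slow-vector clause with constants `σ, C, ν₀, K`; the cell-energy clauses with constants `Cf, νf, Kf`): regime pins
`ν₁, K₁`, template constants `Λ₀, θ₀` and an error law `C₁ρ^{σ₁}`, uniform in the carrier, such that for every permissible regular Lagrangian
carrier `E` on the template and every class `R` there is `m⋆` beyond which, for EVERY window shape `S` (`OddSmall β`, `NearIso lo hi`) and every
class-`R` datum, the level-`m` truncated problem with the RENORMALISED tensor `kbar_m · renormStep Φ (gain/cellVisc_{m+1}²) S` has a weak solution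
(tensor Lions/Galerkin along the bounded divergence-free partial sum — the ad-lit tensor road), and every weak solution `u` of the level-`(m+1)`
truncated problem with viscosity tensor `kbar_{m+1}·S` and every weak solution `v` of that level-`m` problem have energy drops on `(1/2, 1)`
within the ratio `1 ± C₁ (N_m/N_{m+1})^{σ₁}` (Armstrong–Vicol Prop. 5.2 / §5.3 in the Lagrangian frames of `b_{≤m}`: the level-`(m+1)` cell
problem IS the package's at `ν = cellVisc_{m+1}`, `n = N_{m+1}`, package time = `a_{m+1} ×` physical time; slow modes `|ℓ| ≤ N_m ρ^{-1/8}` by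
(T3); rate errors `e ≤ C(ρ^{σ/4} + ρ^{σ/8})` by (T2)/(T3), distortion `≤ θ₀ρ^{1/16}` by (T4), refresh transients `≤ ρ^{1/16}` by (T5).  The
comparison must be obtained RELATIVE TO THE DROP at the level of the dissipation integrals `2∫₀ᵗ⟨kbar·S∇u, ∇u⟩` — clause (V) is decay-relative
for exactly this purpose — and NOT as an absolute `L∞L²` bound divided by an a-priori drop: the only a-priori drop is `stub_baseT`'s
`(1 − e^{−4π²kbar_m lo})E₀`, and `kbar_m → 0`; the `E`-dependent slack of clause (C) and the class `R` go into `m⋆`). -/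
theorem stub_oneLevelL : ∀ k (W : Literature.Analysis.FluidPDE.LatticeShear.LatticeWord k) (M : ℝ) (hM : 0 < M) (c : ℝ), 0 < c →
    ∀ (Φ : Torus.Visc4 (Fin 3) → Torus.Visc4 (Fin 3)) (lo hi Λ β σ C ν₀ K Cf νf Kf : ℝ),
      0 < lo → lo ≤ 1 → 1 ≤ hi → 1 < Λ → 0 ≤ β → WindowClause Φ lo hi Λ β →
      0 < σ → 0 ≤ C → 0 < ν₀ → 0 < K → SlowVectorClause W M hM c Φ lo hi Λ β σ C ν₀ K →
      0 ≤ Cf → 0 < νf → 0 < Kf → CellEnergyClauses W M hM c lo hi Λ β Cf νf Kf →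
      ∃ ν₁ > (0:ℝ), ∃ K₁ > (0:ℝ), ∃ Λ₀ : ℕ, ∃ θ₀ > (0:ℝ), ∃ C₁ > (0:ℝ), ∃ σ₁ > (0:ℝ),
        ∀ E : Literature.Analysis.FluidPDE.LatticeShear.LagrangianLatticeCarrier k, E.design = W.stretch M hM → E.gain = c → E.nu0 = ν₁ → E.K = K₁ → E.LPermissible → E.Regular → (∀ m, Λ₀ * E.N m ≤ E.N (m + 1)) → (∀ m, E.N m ^ 2 ≤ E.N (m + 1)) → (∀ m, E.cellVisc (m + 1) * ((E.N (m + 1) : ℝ) / E.N m) ^ (1 / 4 : ℝ) ≤ 1) → (∀ m, E.K * ((E.N (m + 1) : ℝ) / E.N m) ^ (1 / 4 : ℝ) ≤ ((E.N (m + 1) : ℝ) / E.N m) * E.cellVisc (m + 1)) → (∀ m, E.θ (m + 1) * ((E.N (m + 1) : ℝ) / E.N m) ^ (1 / 16 : ℝ) ≤ θ₀) → (∀ m, ((E.N (m + 1) : ℝ) / E.N m) ^ (1 / 16 : ℝ) * E.physPeriod (m + 1) ≤ E.refresh (m + 1)) →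
        ∀ R : ℝ≥0, ∃ mstar : ℕ, ∀ m, mstar ≤ m →
          ∀ S : Torus.Visc4 (Fin 3), Torus.OddSmall S β → Torus.NearIso S lo hi →
          ∀ (w₀ : VF), IsDatum w₀ → InClass R w₀ →
          ∀ u v : ℝ → VF, TSol E (m + 1) (E.kbar (m + 1) • S) w₀ u →
            TSol E m (E.kbar m • renormStep Φ (E.gain / E.cellVisc (m + 1) ^ 2) S) w₀ v →
            ∀ᵐ t ∂(volume.restrict (Ioo (1/2 : ℝ) 1)),
              (1 - C₁ * ((E.N m : ℝ) / E.N (m + 1)) ^ σ₁) * drop w₀ v t ≤ drop w₀ u t := by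
  sorry

/-- (M; DISCHARGED by name from p609829 exactly as in the registered r22 v10 — statement byte-identical) Telescoping: the chain gives the cascade (`∏ (1 − Cρ_m^σ) ≥ θ > 0` over the super-geometric template, existence threaded downwards). -/
theorem stub_cascadeT : ∀ k (E : LatticeShear.LagrangianLatticeCarrier k), E.LPermissible → (∀ m, E.N m ^ 2 ≤ E.N (m + 1)) →
    ChainLower E → Cascade E := by
  intro k E hP hsq hCh
  exact cascade_of_chainLower E hP hsq hCh



/-! ## Composition -/

/-- Composition (kernel-checked, no sorry outside the stubs): the seven stubs, consumed BY NAME, give the crux — v9's composition with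
`Chain E` supplied by `chain_of_pieces stub_baseT stub_oneLevelL` from the re-cut cell package (`stub_cellLawV` + `stub_cellEnergyT`).
This is the ONLY theorem of the file whose conclusion is the crux decl (skeleton audit rule: the crux-headed theorem may carry no `Prop`
hypotheses other than registered obligations, so there is no separate hypothesis-form `_of_stubs`). -/
theorem LagrangianRenormalisationStep_of : LagrangianRenormalisationStep := by
  intro k W c₀ hc₀ hiso hlaw
  obtain ⟨M, hM, c, hc', Φ, lo, hlo, hi, hlo1, hhi1, Λ, hΛ, β, hβ, hwin, σ, hσ, C, hC, ν₀, hν₀, K, hK, hV⟩ := cellLawV_of_cellLawVNoEx stub_cellLawV k W c₀ hc₀ hiso hlaw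
  obtain ⟨Cf, hCf, νf, hνf, Kf, hKf, hEcl⟩ := cellEnergyT_of_cellEnergyTNoE stub_cellEnergyT k W M hM c hc' lo hi Λ β hlo hlo1 hhi1 hΛ hβ
  obtain ⟨ν₁, hν₁, K₁, hK₁, Λ₀, θ₀, hθ₀, hchain⟩ :=
    chainLower_of_pieces stub_baseT (oneLevel_of_oneLevelNoExists stub_oneLevelL) k W M hM c hc' Φ lo hi Λ β σ C ν₀ K Cf νf Kf hlo hlo1 hhi1 hΛ hβ hwin hσ hC hν₀ hK hV hCf hνf hKf hEcl
  obtain ⟨Λ₁, θs, hθs, htail⟩ := stub_tailL k (W.stretch M hM)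
  refine ⟨M, hM, c, hc', ν₁, hν₁, K₁, hK₁, max Λ₀ Λ₁, min θ₀ θs, lt_min hθ₀ hθs, ?_⟩
  intro E hW hg hn hK' hP hR hsep hsq h2 h3 h4m h5
  -- v17: (T4) at `min θ₀ θs` gives the chain's clause at `θ₀` and the tail stub's at `θs` (monotone in the budget)
  have h4 : ∀ m, E.θ (m + 1) * ((E.N (m + 1) : ℝ) / E.N m) ^ (1 / 16 : ℝ) ≤ θ₀ := fun m => (h4m m).trans (min_le_left _ _)
  have hsep0 : ∀ m, Λ₀ * E.N m ≤ E.N (m + 1) := fun m =>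
    le_trans (Nat.mul_le_mul_right _ (le_max_left Λ₀ Λ₁)) (hsep m)
  have hsep1 : ∀ m, Λ₁ * E.N m ≤ E.N (m + 1) := fun m =>
    le_trans (Nat.mul_le_mul_right _ (le_max_right Λ₀ Λ₁)) (hsep m)
  have hCh : ChainLower E := hchain E hW hg hn hK' hP hR hsep0 hsq h2 h3 h4 h5
  obtain ⟨a, ha, hcas⟩ := stub_cascadeT k E hP hsq hCh
  intro R
  obtain ⟨mstar, θ, hθ, j₁, hj₁⟩ := hcas R
  have hlo' : 0 < E.kbar mstar * a := mul_pos (E.kbar_pos mstar) ha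
  set cb : ℝ := 1 - Real.exp (-(4 * Real.pi ^ 2 * (E.kbar mstar * a))) with hcb_def
  have hcb : 0 < cb := by
    have hexp : Real.exp (-(4 * Real.pi ^ 2 * (E.kbar mstar * a))) < 1 := by
      rw [Real.exp_lt_one_iff]
      have : 0 < 4 * Real.pi ^ 2 * (E.kbar mstar * a) := by positivity
      linarith
    rw [hcb_def]; linarith
  obtain ⟨j₂, hj₂⟩ := htail E hW hP hR hsep1 hsq h2 (min θ₀ θs) (min_le_right _ _) h4m (θ * cb / 2) (by positivity)
  refine ⟨θ * cb / 2, by positivity, max j₁ j₂, ?_⟩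
  intro j hj w₀ hH1 hmean hdiv hclass w hw
  have hdat : IsDatum w₀ := ⟨hH1, hmean, hdiv⟩
  have hcl : InClass R w₀ := hclass
  obtain ⟨u, hu⟩ := stub_existsL k E hP hR j w₀ hdat
  obtain ⟨𝔸s, hi', hNI, hrest⟩ := hj₁ j (le_trans (le_max_left _ _) hj)
  obtain ⟨v, hv, hratio⟩ := hrest w₀ u hdat hcl hu
  have hbase := stub_baseT k E hP hR mstar 𝔸s (E.kbar mstar * a) hi' hlo' hNI w₀ v hdat hv
  have htl := hj₂ j (le_trans (le_max_right _ _) hj) w₀ w u hdat hw hu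
  filter_upwards [hbase, hratio, htl] with t hb hr ht
  have h1 : θ * (cb * Torus.vectorL2Sq w₀) ≤ θ * drop w₀ v t := mul_le_mul_of_nonneg_left hb hθ.le
  have e : Torus.vectorL2Sq w₀ = ∫ x, ‖w₀ x‖ ^ 2 := rfl
  unfold drop at h1 hr ht
  rw [← e]
  nlinarith [h1, hr, ht, hθ, hcb]

end

end Summit.AnomalousDissipation.AnomalousDissipation.Cruxes.LagrangianRenormalisationStep.OneLevel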